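import Mathlib
import Literature.NumberTheory.Sieve.ShnirelmanGoldbachGap
import Literature.NumberTheory.LFunctions.ChebyshevCostaPereira
import HarnessLib

/-!
# An explicit Shnirel'man–Goldbach theorem, continued (VII): `43`, then `41` primes unconditionally (`45` → `43` → `41`; `39` under Rosser–Schoenfeld (3.3) unchanged)

Topic `Literature/NumberTheory/Sieve`; namespace `Literature.NumberTheory.Sieve.ShnirelmanGoldbachExplicit` (continued —
this is §26–§27 of the story of `ShnirelmanGoldbachExplicit.lean` (§1–§12), `ShnirelmanGoldbachFlatten.lean` (§13–§15),
`ShnirelmanGoldbachBonferroni.lean` (§16–§19), `ShnirelmanGoldbachShifts.lean` (§20–§21), `ShnirelmanGoldbachCells.lean` (§22),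
`ShnirelmanGoldbachThree.lean` (§23–§24) and `ShnirelmanGoldbachGap.lean` (§25), kept in its own module for the gate's size
cap).  Cell `parity-ideate` seat p5: g20 ROUND-42 «HARMONIC» (`round42/SchnirelmannHarmonic.lean` sha16 a53c05b2c3cf7829,
its §D–§F, with the needed §1/§2/§3/§4/§6.3/§7.3/§8.1 helper copies) and g21 ROUND-43 «c₀» (`round43/SchnirelmannCP41.lean`
sha16 45e36eb3a7421e17, its §E–§F and four lemmas), landed with statements and proofs verbatim (helpers `private`,
verbatim `private` copies of the earlier modules' private helpers, as in the source).  The TwoResidue-side input of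
§26 — the harmonic constant `(γ + log 2)/2 ≥ 0.6351` restored in the divisor-sum minorant and the cell polynomial
`TlowK4(l) = 0.3658 l² + 0.3394 l − 1.3336` (`Qsum_ge_kappa4`) — is §11 of `TwoResidueSelbergSumExplicit.lean`; the
Chebyshev-side input of §27 — Costa Pereira's `m = 17` scheme, `0.9636·x ≤ ψ(x)` for `x ≥ 227` — is
`Literature/NumberTheory/LFunctions/ChebyshevCostaPereira.lean`.  No named facts, no definitions, no instances, no notation.

## References
* [Nathanson1996] M. B. Nathanson, *Additive Number Theory: The Classical Bases*, GTM 164 (1996), §7.3, Theorems 7.8–7.9.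
* [BatemanDiamond2004] P. T. Bateman, H. G. Diamond, *Analytic Number Theory: An Introductory Course* (2004), §13.4
  (13.13)–(13.14), Lemma 13.11, Theorem 13.8.
* [CostaPereira1989] N. Costa Pereira, *Elementary estimates for the Chebyshev function ψ(x) and for the Möbius function
  M(x)*, Acta Arith. 52 (1989) 307–337, §2 (2.41) (the `m = 17` scheme; §27's count input, via `ChebyshevCostaPereira.lean`).
* [RosserSchoenfeld1962] J. B. Rosser, L. Schoenfeld, *Approximate formulas for some functions of prime numbers*,
  Illinois J. Math. 6 (1962), Theorem 2, eq. (3.3) (the conditional column's input, unchanged here).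

## Content

* §26 (ROUND-42 «HARMONIC»): ONE input varied relative to §24–§25 — the cell polynomial `TlowK3` ↦ `TlowK4` (the constant
  `0.6351` of the odd harmonic sum restored, `TwoResidueSelbergSumExplicit` §11); the sieve steps re-read through it:
  the explicit large-sieve step `explicit_of_largeSieve_kappa4_c` (`Λ ≥ 60`) and its Goldbach-count wrapper
  `goldbachCount_le_of_numeric4_c`, the pair-sieve step from `e^38` (`explicit_of_largeSieve_kappa4_c38`,
  `pairCount_le_of_numeric4_c38`, `pairCount_le_of_numeric4_c`), the instances: pair sieves `13.01` from `e^38`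
  (`pairCount_le_1301`), `11.84` from `e^109` (`pairCount_le_1184`), `11.52` from `e^190` (`pairCount_le_1152`), the Goldbach
  sieve `11.33` from `e^314` (`goldbachCount_le_1133`); the unconditional five-regime glue from `L₁ ≥ 38` with `h ≥ 21`
  (`half_count_ge_allN_three38`), the count `x/42` above `e^330` (`goldbach_even_count_ge_42_exp330`), `σ(B) ≥ 1/21`
  (`half_count_ge_allN_21`, `schnirelmannDensity_half_ge_21`) and **`schnirelmann_goldbach_le_43`** (Mann: `2·21 + 1`):
  unconditionally every `N ≥ 2` is a sum of at most `43` primes.  (The Rosser–Schoenfeld column stays at `39`, §25.)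
* §27 (ROUND-43 «c₀»): ONE input varied relative to §26 — the Chebyshev lower constant: Sylvester's `0.93919` (above
  `10¹²`) / `0.9212` (above `10⁶`) ↦ Costa Pereira's `0.9636` above `227` (`CostaPereira.primeCounting_ge`, PROVED in
  `ChebyshevCostaPereira.lean`): `primeCountingLowerMul_09636`, the first moment `c₁ = 0.9636²/2`
  (`sum_goldbachCount_ge_04642`), the Goldbach sieve `11.34` from `e^308` (`goldbachCount_le_1134`), the five-regime glue
  re-parametrised (`half_count_ge_allN_cp38`: `h ≥ 20`, one-shift reach `1.9272·h`, slopes `2k·0.9636`), the count `x/40`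
  above `e^324` (`goldbach_even_count_ge_40_exp324`), `σ(B) ≥ 1/20` (`half_count_ge_allN_20`,
  `schnirelmannDensity_half_ge_20`) and **`schnirelmann_goldbach_le_41`** (Mann: `2·20 + 1`): unconditionally every `N ≥ 2`
  is a sum of at most `41` primes.

Table of the series (K unconditional / under Rosser–Schoenfeld (3.3)): … → §22 47/43 → §23–§24 45/41 → §25 45/39 → §26 43/39
→ §27 41/39.  Print calibration (NOT formalised, not used): Klimov 1975 (`55`), Vaughan 1977 (`27`), Deshouillers 1977 (`26`),
Riesel–Vaughan 1983 (`19`), Ramaré 1995 (even `n`: `≤ 6` primes), Helfgott 2013 (`K ≤ 4`).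
-/

namespace Literature.NumberTheory.Sieve.ShnirelmanGoldbachExplicit


open Finset Real
open scoped Classical Pointwise
open Literature.NumberTheory.Sieve Literature.Combinatorics.Additive
open Literature.NumberTheory.Sieve.GoldbachSieveEight (ft Qsum sum_ft_le_Qsum)
open Literature.NumberTheory.Sieve.TwoResidueSelbergExplicit (kappaSet2 TlowK2 sum_ft_ge_kappa2 Qsum_ge_kappa2
  kappaSet3 TlowK3 sum_ft_ge_kappa3 Qsum_ge_kappa3 TlowK4 sum_ft_ge_kappa4 Qsum_ge_kappa4)
open Literature.NumberTheory.Sieve.GoldbachLinnik (oddSingularFactor oddSingularFactor_nonneg)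
open Literature.NumberTheory.Sieve.RomanoffExplicit (PrimeCountingLowerMul primeCountingLowerMul_09212
  primeCounting_ge_div45)

/-! ### Private copies (verbatim) of the helpers of §1–§25 used below -/

/-- `TlowK4` is increasing on `[0, ∞)` (`TlowK4 l − TlowK4 l₁ = (l − l₁)(0.3658(l + l₁) + 0.3394)`). [folklore] -/
private theorem TlowK4_mono {l₁ l : ℝ} (h₁ : 0 ≤ l₁) (h : l₁ ≤ l) : TlowK4 l₁ ≤ TlowK4 l := by
  unfold TlowK4
  have h2 : (0 : ℝ) ≤ 0.3658 * (l + l₁) + 0.3394 := by nlinarith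
  nlinarith [mul_nonneg (sub_nonneg.2 h) h2]

/-- `TlowK4(l₁) ≥ 100` for `l₁ ≥ 19.11` (indeed for `l₁ ≥ 16.4`; `TlowK4(19.11) = 138.7`). [folklore] -/
private theorem TlowK4_ge {l₁ : ℝ} (h₁ : 19.11 ≤ l₁) : 100 ≤ TlowK4 l₁ := by
  unfold TlowK4; nlinarith [h₁, sq_nonneg (l₁ - 19.11)]

/-- `TlowK4(l₁) ≥ 88` for `l₁ ≥ 17.6` (`TlowK4(17.6) = 117.9`). [folklore] -/
private theorem TlowK4_ge88 {l₁ : ℝ} (h₁ : 17.6 ≤ l₁) : 88 ≤ TlowK4 l₁ := by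
  unfold TlowK4; nlinarith [h₁, sq_nonneg (l₁ - 17.6)]

/-- The halving map: `#{even N ∈ (0, 2y] : N = p + q} ≤ #{b ∈ (0, y] : b ∈ B}`, `B = {0, 1} ∪ {m : 2m = p + q}`
(`N ↦ N/2`). [folklore] -/
private theorem even_goldbach_card_le_half (y : ℕ) :
    #{N ∈ Ioc 0 (2 * y) | Even N ∧ ∃ p q : ℕ, p.Prime ∧ q.Prime ∧ p + q = N}
      ≤ #{b ∈ Ioc 0 y | b ∈ (({0, 1} : Set ℕ) ∪ {m | ∃ p q : ℕ, p.Prime ∧ q.Prime ∧ p + q = 2 * m})} := by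
  refine card_le_card_of_injOn (fun N => N / 2) ?_ ?_
  · intro N hN
    rw [mem_coe, mem_filter, mem_Ioc] at hN
    obtain ⟨⟨hN0, hNy⟩, ⟨k, hk⟩, p, q, hp, hq, hpq⟩ := hN
    rw [mem_coe, mem_filter, mem_Ioc]
    dsimp only
    exact ⟨⟨by omega, by omega⟩, Or.inr ⟨p, q, hp, hq, by omega⟩⟩
  · intro N hN N' hN' h
    rw [mem_coe, mem_filter] at hN hN'
    obtain ⟨k, hk⟩ := hN.2.1
    obtain ⟨k', hk'⟩ := hN'.2.1
    simp only at h
    omega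

/-- `σ(S) ≥ 1/K` from `S(N) ≥ N/K` (`N ≥ 1`), for any set `S`. [folklore] -/
private theorem schnirelmannDensity_ge_of_count' {S : Set ℕ} [DecidablePred (· ∈ S)] {K : ℕ}
    (h : ∀ N : ℕ, 1 ≤ N → (N : ℝ) / K ≤ #{a ∈ Ioc 0 N | a ∈ S}) :
    (1 : ℝ) / K ≤ schnirelmannDensity S := by
  rw [le_schnirelmannDensity_iff]
  intro n hn
  have hn' : (0 : ℝ) < n := by exact_mod_cast hn
  rw [le_div_iff₀ hn']
  have := h n hn
  calc (1 : ℝ) / K * n = (n : ℝ) / K := by ring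
    _ ≤ _ := by convert this using 2

/-- `f(n) ≥ 1`. [folklore] -/
private theorem one_le_oddSingularFactor' (n : ℕ) : 1 ≤ oddSingularFactor n := by
  unfold oddSingularFactor
  have h : ∏ _p ∈ n.primeFactors.filter (2 < ·), (1 : ℝ)
      ≤ ∏ p ∈ n.primeFactors.filter (2 < ·), (((p : ℝ) - 1) / ((p : ℝ) - 2)) := by
    refine Finset.prod_le_prod (fun _ _ => zero_le_one) fun p hp => ?_
    rw [Finset.mem_filter] at hp
    have hp3 : (3 : ℝ) ≤ p := by exact_mod_cast hp.2
    rw [le_div_iff₀ (by linarith)]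
    linarith
  simpa using h

/-- `2⁵⁹ ≤ e⁴¹`. [folklore] -/
private theorem two_pow_59_le_exp_41 : (2 : ℝ) ^ 59 ≤ Real.exp 41 := by
  have he : (2.718281828 : ℝ) ≤ Real.exp 1 := by have := Real.exp_one_gt_d9; linarith
  have h := pow_le_pow_left₀ (by norm_num) he 41
  rw [← Real.exp_nat_mul] at h
  norm_num at h
  exact le_trans (by norm_num) h

/-- `((2y − 3 : ℕ) : ℝ) = 2y − 3` for `y ≥ 2`. [folklore] -/
private theorem cast_two_mul_sub_three {y : ℕ} (hy : 2 ≤ y) : ((2 * y - 3 : ℕ) : ℝ) = 2 * (y : ℝ) - 3 := by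
  have h3y : 3 ≤ 2 * y := by omega
  rw [Nat.cast_sub h3y]
  push_cast
  ring

/-- `log n ≤ 14` for `n < 10⁶` (`10⁶ ≤ 2.7¹⁴ ≤ e¹⁴`). [folklore] -/
private theorem log_le_14_of_lt {n : ℕ} (hn0 : 0 < n) (h6 : n < 10 ^ 6) : Real.log (n : ℝ) ≤ 14 := by
  have hn0' : (0 : ℝ) < n := by exact_mod_cast hn0
  have hy6 : (n : ℝ) ≤ (2.7 : ℝ) ^ 14 := by
    have : (n : ℝ) < 10 ^ 6 := by exact_mod_cast h6
    have h27 : (10 : ℝ) ^ 6 ≤ (2.7 : ℝ) ^ 14 := by norm_num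
    linarith
  have he : (2.7 : ℝ) ≤ Real.exp 1 := by have := Real.exp_one_gt_d9; linarith
  have h14 : (2.7 : ℝ) ^ 14 ≤ Real.exp 14 := by
    rw [show (14 : ℝ) = ((14 : ℕ) : ℝ) * 1 by norm_num, Real.exp_nat_mul]
    exact pow_le_pow_left₀ (by norm_num) he 14
  have := Real.log_le_log hn0' (hy6.trans h14)
  rwa [Real.log_exp] at this

/-- `((2y − q : ℕ) : ℝ) = 2y − q` for `q ≤ 2y`. [folklore] -/
private theorem cast_two_mul_sub {y q : ℕ} (h : q ≤ 2 * y) : ((2 * y - q : ℕ) : ℝ) = 2 * (y : ℝ) - q := by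
  rw [Nat.cast_sub h]
  push_cast
  ring

/-- `f(2) = 1`. [folklore] -/
private theorem oddSingularFactor_two' : oddSingularFactor 2 = 1 := by
  rw [show (2 : ℕ) = 2 ^ 1 * 1 by norm_num, GoldbachLinnik.oddSingularFactor_two_pow_mul 1 one_ne_zero,
    GoldbachLinnik.oddSingularFactor_one]

/-- `f(4) = 1`. [folklore] -/
private theorem oddSingularFactor_four : oddSingularFactor 4 = 1 := by
  rw [show (4 : ℕ) = 2 ^ 2 * 1 by norm_num, GoldbachLinnik.oddSingularFactor_two_pow_mul 2 one_ne_zero,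
    GoldbachLinnik.oddSingularFactor_one]

/-- `f(8) = 1`. [folklore] -/
private theorem oddSingularFactor_eight : oddSingularFactor 8 = 1 := by
  rw [show (8 : ℕ) = 2 ^ 3 * 1 by norm_num, GoldbachLinnik.oddSingularFactor_two_pow_mul 3 one_ne_zero,
    GoldbachLinnik.oddSingularFactor_one]

/-- `f(6) = 2` (the factor `(3−1)/(3−2)`). [folklore] -/
private theorem oddSingularFactor_six : oddSingularFactor 6 = 2 := by
  rw [show (6 : ℕ) = 2 ^ 1 * 3 by norm_num, GoldbachLinnik.oddSingularFactor_two_pow_mul 1 (by norm_num)]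
  show ∏ p ∈ (Nat.primeFactors 3).filter (2 < ·), (((p : ℝ) - 1) / ((p : ℝ) - 2)) = 2
  rw [Nat.prime_three.primeFactors, Finset.filter_singleton, if_pos (by norm_num), Finset.prod_singleton]
  norm_num

/-- `f(10) = 4/3`. [folklore] -/
private theorem oddSingularFactor_ten : oddSingularFactor 10 = 4 / 3 := by
  rw [show (10 : ℕ) = 2 ^ 1 * 5 by norm_num, GoldbachLinnik.oddSingularFactor_two_pow_mul 1 (by norm_num)]
  show ∏ p ∈ (Nat.primeFactors 5).filter (2 < ·), (((p : ℝ) - 1) / ((p : ℝ) - 2)) = 4 / 3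
  rw [Nat.prime_five.primeFactors, Finset.filter_singleton, if_pos (by norm_num), Finset.prod_singleton]
  norm_num

/-- `f(12) = 2`. [folklore] -/
private theorem oddSingularFactor_twelve : oddSingularFactor 12 = 2 := by
  rw [show (12 : ℕ) = 2 ^ 2 * 3 by norm_num, GoldbachLinnik.oddSingularFactor_two_pow_mul 2 (by norm_num)]
  show ∏ p ∈ (Nat.primeFactors 3).filter (2 < ·), (((p : ℝ) - 1) / ((p : ℝ) - 2)) = 2
  rw [Nat.prime_three.primeFactors, Finset.filter_singleton, if_pos (by norm_num), Finset.prod_singleton]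
  norm_num

/-- `f(14) = 6/5`. [folklore] -/
private theorem oddSingularFactor_fourteen : oddSingularFactor 14 = 6 / 5 := by
  rw [show (14 : ℕ) = 2 ^ 1 * 7 by norm_num, GoldbachLinnik.oddSingularFactor_two_pow_mul 1 (by norm_num)]
  show ∏ p ∈ (Nat.primeFactors 7).filter (2 < ·), (((p : ℝ) - 1) / ((p : ℝ) - 2)) = 6 / 5
  rw [(by norm_num : Nat.Prime 7).primeFactors, Finset.filter_singleton, if_pos (by norm_num), Finset.prod_singleton]
  norm_num

/-- `f(16) = 1`. [folklore] -/
private theorem oddSingularFactor_sixteen : oddSingularFactor 16 = 1 := by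
  rw [show (16 : ℕ) = 2 ^ 4 * 1 by norm_num, GoldbachLinnik.oddSingularFactor_two_pow_mul 4 one_ne_zero,
    GoldbachLinnik.oddSingularFactor_one]

/-- `f(18) = 2`. [folklore] -/
private theorem oddSingularFactor_eighteen : oddSingularFactor 18 = 2 := by
  rw [show (18 : ℕ) = 2 ^ 1 * 9 by norm_num, GoldbachLinnik.oddSingularFactor_two_pow_mul 1 (by norm_num)]
  show ∏ p ∈ (Nat.primeFactors 9).filter (2 < ·), (((p : ℝ) - 1) / ((p : ℝ) - 2)) = 2
  rw [show (9 : ℕ) = 3 ^ 2 by norm_num, Nat.primeFactors_prime_pow (by norm_num) Nat.prime_three,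
    Finset.filter_singleton, if_pos (by norm_num), Finset.prod_singleton]
  norm_num

/-- `f(20) = 4 / 3`. [folklore] -/
private theorem oddSingularFactor_twenty : oddSingularFactor 20 = 4 / 3 := by
  rw [show (20 : ℕ) = 2 ^ 2 * 5 by norm_num, GoldbachLinnik.oddSingularFactor_two_pow_mul 2 (by norm_num)]
  show ∏ p ∈ (Nat.primeFactors 5).filter (2 < ·), (((p : ℝ) - 1) / ((p : ℝ) - 2)) = 4 / 3
  rw [Nat.prime_five.primeFactors, Finset.filter_singleton, if_pos (by norm_num), Finset.prod_singleton]
  norm_num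

/-- `f(22) = 10 / 9`. [folklore] -/
private theorem oddSingularFactor_twentytwo : oddSingularFactor 22 = 10 / 9 := by
  rw [show (22 : ℕ) = 2 ^ 1 * 11 by norm_num, GoldbachLinnik.oddSingularFactor_two_pow_mul 1 (by norm_num)]
  show ∏ p ∈ (Nat.primeFactors 11).filter (2 < ·), (((p : ℝ) - 1) / ((p : ℝ) - 2)) = 10 / 9
  rw [(by norm_num : Nat.Prime 11).primeFactors, Finset.filter_singleton, if_pos (by norm_num), Finset.prod_singleton]
  norm_num

/-- `f(24) = 2`. [folklore] -/
private theorem oddSingularFactor_twentyfour : oddSingularFactor 24 = 2 := by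
  rw [show (24 : ℕ) = 2 ^ 3 * 3 by norm_num, GoldbachLinnik.oddSingularFactor_two_pow_mul 3 (by norm_num)]
  show ∏ p ∈ (Nat.primeFactors 3).filter (2 < ·), (((p : ℝ) - 1) / ((p : ℝ) - 2)) = 2
  rw [Nat.prime_three.primeFactors, Finset.filter_singleton, if_pos (by norm_num), Finset.prod_singleton]
  norm_num

/-- `f(26) = 12 / 11`. [folklore] -/
private theorem oddSingularFactor_twentysix : oddSingularFactor 26 = 12 / 11 := by
  rw [show (26 : ℕ) = 2 ^ 1 * 13 by norm_num, GoldbachLinnik.oddSingularFactor_two_pow_mul 1 (by norm_num)]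
  show ∏ p ∈ (Nat.primeFactors 13).filter (2 < ·), (((p : ℝ) - 1) / ((p : ℝ) - 2)) = 12 / 11
  rw [(by norm_num : Nat.Prime 13).primeFactors, Finset.filter_singleton, if_pos (by norm_num), Finset.prod_singleton]
  norm_num

/-- `f(28) = 6 / 5`. [folklore] -/
private theorem oddSingularFactor_twentyeight : oddSingularFactor 28 = 6 / 5 := by
  rw [show (28 : ℕ) = 2 ^ 2 * 7 by norm_num, GoldbachLinnik.oddSingularFactor_two_pow_mul 2 (by norm_num)]
  show ∏ p ∈ (Nat.primeFactors 7).filter (2 < ·), (((p : ℝ) - 1) / ((p : ℝ) - 2)) = 6 / 5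
  rw [(by norm_num : Nat.Prime 7).primeFactors, Finset.filter_singleton, if_pos (by norm_num), Finset.prod_singleton]
  norm_num

/-- `f(30) = 8 / 3`. [folklore] -/
private theorem oddSingularFactor_thirty : oddSingularFactor 30 = 8 / 3 := by
  rw [show (30 : ℕ) = 2 ^ 1 * 15 by norm_num, GoldbachLinnik.oddSingularFactor_two_pow_mul 1 (by norm_num)]
  show ∏ p ∈ (Nat.primeFactors 15).filter (2 < ·), (((p : ℝ) - 1) / ((p : ℝ) - 2)) = 8 / 3
  rw [show (15 : ℕ) = 3 * 5 by norm_num, Nat.primeFactors_mul (by norm_num) (by norm_num),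
    Nat.prime_three.primeFactors, Nat.prime_five.primeFactors, Finset.filter_union, Finset.filter_singleton,
    Finset.filter_singleton, if_pos (by norm_num), if_pos (by norm_num), Finset.prod_union (by simp),
    Finset.prod_singleton, Finset.prod_singleton]
  norm_num

/-- `f(32) = 1`. [folklore] -/
private theorem oddSingularFactor_thirtytwo : oddSingularFactor 32 = 1 := by
  rw [show (32 : ℕ) = 2 ^ 5 * 1 by norm_num, GoldbachLinnik.oddSingularFactor_two_pow_mul 5 one_ne_zero,
    GoldbachLinnik.oddSingularFactor_one]

/-- `f(34) = 16 / 15`. [folklore] -/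
private theorem oddSingularFactor_thirtyfour : oddSingularFactor 34 = 16 / 15 := by
  rw [show (34 : ℕ) = 2 ^ 1 * 17 by norm_num, GoldbachLinnik.oddSingularFactor_two_pow_mul 1 (by norm_num)]
  show ∏ p ∈ (Nat.primeFactors 17).filter (2 < ·), (((p : ℝ) - 1) / ((p : ℝ) - 2)) = 16 / 15
  rw [(by norm_num : Nat.Prime 17).primeFactors, Finset.filter_singleton, if_pos (by norm_num), Finset.prod_singleton]
  norm_num

/-- `f(36) = 2`. [folklore] -/
private theorem oddSingularFactor_thirtysix : oddSingularFactor 36 = 2 := by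
  rw [show (36 : ℕ) = 2 ^ 2 * 9 by norm_num, GoldbachLinnik.oddSingularFactor_two_pow_mul 2 (by norm_num)]
  show ∏ p ∈ (Nat.primeFactors 9).filter (2 < ·), (((p : ℝ) - 1) / ((p : ℝ) - 2)) = 2
  rw [show (9 : ℕ) = 3 ^ 2 by norm_num, Nat.primeFactors_prime_pow (by norm_num) Nat.prime_three,
    Finset.filter_singleton, if_pos (by norm_num), Finset.prod_singleton]
  norm_num

/-- `f(38) = 18 / 17`. [folklore] -/
private theorem oddSingularFactor_thirtyeight : oddSingularFactor 38 = 18 / 17 := by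
  rw [show (38 : ℕ) = 2 ^ 1 * 19 by norm_num, GoldbachLinnik.oddSingularFactor_two_pow_mul 1 (by norm_num)]
  show ∏ p ∈ (Nat.primeFactors 19).filter (2 < ·), (((p : ℝ) - 1) / ((p : ℝ) - 2)) = 18 / 17
  rw [(by norm_num : Nat.Prime 19).primeFactors, Finset.filter_singleton, if_pos (by norm_num), Finset.prod_singleton]
  norm_num

/-- The boundary numerics from `L ≥ 41`: `(E/4 + 1)·L² ≤ 0.01·E²` once `100 L² ≤ E` (copy of the tree's private
lemma). [folklore] -/
private theorem tail_numeric'' {L E : ℝ} (hL : 41 ≤ L) (hEL : 100 * L ^ 2 ≤ E) :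
    (E / 4 + 1) * L ^ 2 ≤ 0.01 * E ^ 2 := by
  have hL2 : (1681 : ℝ) ≤ L ^ 2 := by nlinarith [hL]
  have hE : (168100 : ℝ) ≤ E := by linarith
  nlinarith [hEL, hE, hL2]

/-- `e^{2.0796} ≥ 8.00096 = 8·1.00012` (`2.0796 = 3·0.6931471808 + 0.0001584576`). [folklore] -/
private theorem exp_20796_ge : (8.00096 : ℝ) ≤ Real.exp 2.0796 := by
  have hl2 : (2 : ℝ) ≤ Real.exp 0.6931471808 := by
    have h1 := Real.exp_log (show (0:ℝ) < 2 by norm_num)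
    have h2 := Real.exp_le_exp.mpr Real.log_two_lt_d9.le
    linarith
  have hsmall : (1.0001584576 : ℝ) ≤ Real.exp 0.0001584576 := by
    have := Real.add_one_le_exp (0.0001584576 : ℝ); linarith
  have hprod : Real.exp (2.0796 : ℝ) = Real.exp 0.6931471808 ^ 3 * Real.exp 0.0001584576 := by
    rw [← Real.exp_nat_mul, ← Real.exp_add]; norm_num
  rw [hprod]
  have h8 : (8 : ℝ) ≤ Real.exp 0.6931471808 ^ 3 := by
    have := pow_le_pow_left₀ (by norm_num : (0:ℝ) ≤ 2) hl2 3
    linarith [show ((2 : ℝ)) ^ 3 = 8 by norm_num]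
  nlinarith [mul_le_mul h8 hsmall (by norm_num) (by positivity)]

/-- `e^{2.7728} ≥ 16.00192 = 16·1.00012` (`2.7728 = 4·0.6931471808 + 0.0002112768`). [folklore] -/
private theorem exp_27728_ge : (16.00192 : ℝ) ≤ Real.exp 2.7728 := by
  have hl2 : (2 : ℝ) ≤ Real.exp 0.6931471808 := by
    have h1 := Real.exp_log (show (0:ℝ) < 2 by norm_num)
    have h2 := Real.exp_le_exp.mpr Real.log_two_lt_d9.le
    linarith
  have hsmall : (1.0002112768 : ℝ) ≤ Real.exp 0.0002112768 := by
    have := Real.add_one_le_exp (0.0002112768 : ℝ); linarith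
  have hprod : Real.exp (2.7728 : ℝ) = Real.exp 0.6931471808 ^ 4 * Real.exp 0.0002112768 := by
    rw [← Real.exp_nat_mul, ← Real.exp_add]; norm_num
  rw [hprod]
  have h16 : (16 : ℝ) ≤ Real.exp 0.6931471808 ^ 4 := by
    have := pow_le_pow_left₀ (by norm_num : (0:ℝ) ≤ 2) hl2 4
    linarith [show ((2 : ℝ)) ^ 4 = 16 by norm_num]
  nlinarith [mul_le_mul h16 hsmall (by norm_num) (by positivity)]

set_option maxHeartbeats 1600000 in

/-- `e^{1.3865} ≥ 4.00048 = 4·1.00012` (`1.3865 = 2·0.6931471808 + 0.0002056384`). [folklore] -/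
private theorem exp_13865_ge : (4.00048 : ℝ) ≤ Real.exp 1.3865 := by
  have hl2 : (2 : ℝ) ≤ Real.exp 0.6931471808 := by
    have h1 := Real.exp_log (show (0:ℝ) < 2 by norm_num)
    have h2 := Real.exp_le_exp.mpr Real.log_two_lt_d9.le
    linarith
  have hsmall : (1.0002056384 : ℝ) ≤ Real.exp 0.0002056384 := by
    have := Real.add_one_le_exp (0.0002056384 : ℝ); linarith
  have hprod : Real.exp (1.3865 : ℝ) = Real.exp 0.6931471808 ^ 2 * Real.exp 0.0002056384 := by
    rw [← Real.exp_nat_mul, ← Real.exp_add]; norm_num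
  rw [hprod]
  have h4 : (4 : ℝ) ≤ Real.exp 0.6931471808 ^ 2 := by
    have := pow_le_pow_left₀ (by norm_num : (0:ℝ) ≤ 2) hl2 2
    linarith [show ((2 : ℝ)) ^ 2 = 4 by norm_num]
  nlinarith [mul_le_mul h4 hsmall (by norm_num) (by positivity)]

/-! ## §26 ROUND-42 «HARMONIC»: the sieve steps of ROUND-40/41 read through `TlowK4` (verbatim up to `TlowK3/TlowK2 ↦ TlowK4`) -/

/-! ### §26.1 The explicit large-sieve step on `TlowK4` (`Λ ≥ 60`; round41 §7.1) -/

set_option maxHeartbeats 1600000 in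
/-- **The explicit large-sieve step on the 68-cell polynomial `TlowK4`** (ROUND-40; as `explicit_of_largeSieve_kappa2_c`
with `Λ ≥ max(60, 38.22 + 2·lc)`: `√N ≥ (L/2)^12/12! ≥ 10^9 ≥ 40·4194305` at `L ≥ 60`, so `X ≥ 2^22` and `Qsum_ge_kappa4`
applies; `TlowK4(l₁) ≥ 100` for `l₁ ≥ 19.11`).
[cite: BatemanDiamond2004, Thm 13.8, §13.4–13.5 pp. 325–328 (explicit form proved here)] -/
theorem explicit_of_largeSieve_kappa4_c {c : ℕ} {lc Λ A : ℝ} (hc4 : 4 ≤ c) (hc40 : c ≤ 40)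
    (hlc : (c : ℝ) * 1.00012 ≤ Real.exp lc) (hΛ : 60 ≤ Λ) (hΛc : 38.22 + 2 * lc ≤ Λ)
    (hA : ∀ L : ℝ, Λ ≤ L → ((c : ℝ) ^ 2 + 1) * L ^ 2
        ≤ (c : ℝ) ^ 2 * (A - 0.02) * TlowK4 (L / 2 - lc))
    {N : ℕ} {C F B : ℝ} (hN : Real.exp Λ ≤ (N : ℝ)) (hF1 : 1 ≤ F)
    (hB : B ≤ 2 * ((Nat.sqrt N / c : ℕ) : ℝ) + 2)
    (hBD : C * GoldbachSieveEight.Qsum ∅ (Nat.sqrt N / c) ≤ (((Nat.sqrt N / c : ℕ) : ℝ) ^ 2 + N - 1) * F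
      + B * GoldbachSieveEight.Qsum ∅ (Nat.sqrt N / c)) :
    C ≤ A * F * (N : ℝ) / Real.log (N : ℝ) ^ 2 := by
  have hN0 : (0 : ℝ) < N := lt_of_lt_of_le (Real.exp_pos Λ) hN
  set L := Real.log (N : ℝ) with hLdef
  have hL : Λ ≤ L := by
    have := Real.log_le_log (Real.exp_pos Λ) hN
    rwa [Real.log_exp] at this
  have hL60 : (60 : ℝ) ≤ L := le_trans hΛ hL
  have hL41 : (41 : ℝ) ≤ L := by linarith
  have hL2pos : 0 < L ^ 2 := by positivity
  have hcpos : 0 < c := by omega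
  have hc0 : (0 : ℝ) < c := by exact_mod_cast hcpos
  have hcR4 : (4 : ℝ) ≤ c := by exact_mod_cast hc4
  have hcR40 : (c : ℝ) ≤ 40 := by exact_mod_cast hc40
  -- E = √N = exp(L/2)
  set E := Real.exp (L / 2) with hEdef
  have hE0 : 0 < E := Real.exp_pos _
  have hE2 : E ^ 2 = N := by
    have : E ^ 2 = Real.exp L := by rw [hEdef, sq, ← Real.exp_add]; ring_nf
    rw [this, hLdef, Real.exp_log hN0]
  have hE8 : (L / 2) ^ 8 / 40320 ≤ E := by
    have := Real.pow_div_factorial_le_exp (L / 2) (by linarith) 8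
    simpa [Nat.factorial] using this
  have hLsq : (1681 : ℝ) ≤ L ^ 2 := by nlinarith [hL41]
  have hL4 : (1681 : ℝ) ^ 2 ≤ (L ^ 2) ^ 2 := pow_le_pow_left₀ (by norm_num) hLsq 2
  have hEL : 100 * L ^ 2 ≤ E := by
    have h1 : (1681 : ℝ) ^ 2 * 1681 * L ^ 2 ≤ (L ^ 2) ^ 2 * L ^ 2 * L ^ 2 := by
      have := mul_le_mul hL4 hLsq (by norm_num) (by positivity)
      nlinarith [this, hL2pos]
    have h2 : (L / 2) ^ 8 / 40320 = (L ^ 2) ^ 2 * L ^ 2 * L ^ 2 / 10321920 := by ring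
    rw [h2] at hE8
    nlinarith [h1, hE8]
  have hE12 : (L / 2) ^ 12 / 479001600 ≤ E := by
    have := Real.pow_div_factorial_le_exp (L / 2) (by linarith) 12
    simpa [Nat.factorial] using this
  have hEbig2 : (1000000000 : ℝ) ≤ E := by
    have h1 : ((30 : ℝ)) ^ 12 ≤ (L / 2) ^ 12 := pow_le_pow_left₀ (by norm_num) (by linarith) 12
    have h2 : ((30 : ℝ)) ^ 12 / 479001600 ≤ E := le_trans (div_le_div_of_nonneg_right h1 (by norm_num)) hE12
    norm_num at h2
    linarith
  -- s = ⌊√N⌋, X = s / c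
  set s := Nat.sqrt N with hsdef
  set X := s / c with hXdef
  have hs2 : (s : ℝ) ^ 2 ≤ N := by exact_mod_cast Nat.sqrt_le' N
  have hs2' : (N : ℝ) < ((s : ℝ) + 1) ^ 2 := by exact_mod_cast Nat.lt_succ_sqrt' N
  have hsE : (s : ℝ) ≤ E := by
    have : (s : ℝ) ^ 2 ≤ E ^ 2 := by rw [hE2]; exact hs2
    exact (pow_le_pow_iff_left₀ (Nat.cast_nonneg s) hE0.le two_ne_zero).mp this
  have hEs : E < (s : ℝ) + 1 := by
    have : E ^ 2 < ((s : ℝ) + 1) ^ 2 := by rw [hE2]; exact hs2'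
    exact (pow_lt_pow_iff_left₀ hE0.le (by positivity) two_ne_zero).mp this
  have hXc : X * c ≤ s := Nat.div_mul_le_self s c
  have hXc' : s + 1 ≤ X * c + c := Nat.lt_div_mul_add hcpos
  have hXcR : (X : ℝ) * c ≤ s := by exact_mod_cast hXc
  have hXcR' : (s : ℝ) + 1 ≤ (X : ℝ) * c + c := by exact_mod_cast hXc'
  have hX0R : (0 : ℝ) ≤ X := Nat.cast_nonneg X
  have hXR : (X : ℝ) ^ 2 * (c : ℝ) ^ 2 ≤ (N : ℝ) := by
    have : ((X : ℝ) * c) ^ 2 ≤ (s : ℝ) ^ 2 := pow_le_pow_left₀ (by positivity) hXcR 2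
    nlinarith [hs2, this]
  have hXlo : E / c - 1 < (X : ℝ) := by
    have h1 : E < (X : ℝ) * c + c := by linarith [hEs, hXcR']
    rw [sub_lt_iff_lt_add, div_lt_iff₀ hc0]; linarith
  have hXhi : (X : ℝ) ≤ E / c := by
    rw [le_div_iff₀ hc0]; linarith [hsE, hXcR]
  have hEc : (4194305 : ℝ) ≤ E / c := by
    rw [le_div_iff₀ hc0]; nlinarith [hEbig2, hcR40]
  have hX0 : (0 : ℝ) < X := by linarith
  have hX262144 : 4194304 ≤ X := by
    have : (4194304 : ℝ) ≤ X := by linarith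
    exact_mod_cast this
  -- log X ≥ l₁ := L/2 − lc
  set l₁ := L / 2 - lc with hl₁def
  have hexp : Real.exp l₁ ≤ (X : ℝ) := by
    rw [hl₁def, Real.exp_sub]
    have hlc0 : (0 : ℝ) < (c : ℝ) * 1.00012 := by positivity
    have h1 : E / Real.exp lc ≤ E / ((c : ℝ) * 1.00012) :=
      div_le_div_of_nonneg_left hE0.le hlc0 hlc
    have h2 : E / ((c : ℝ) * 1.00012) ≤ E / c - 1 := by
      rw [show E / ((c : ℝ) * 1.00012) = E / c / 1.00012 by rw [div_div],
        div_le_iff₀ (by norm_num : (0 : ℝ) < 1.00012)]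
      linarith [hEc]
    linarith [hXlo]
  have hl : l₁ ≤ Real.log X := by
    rw [Real.le_log_iff_exp_le hX0]; exact hexp
  have hl₁ : (19.11 : ℝ) ≤ l₁ := by rw [hl₁def]; linarith
  -- Q ≥ TlowK4(log X) ≥ TlowK4(l₁) ≥ 100
  set Q := GoldbachSieveEight.Qsum ∅ X with hQdef
  have hQ : TlowK4 (Real.log X) ≤ Q := Qsum_ge_kappa4 hX262144
  have hQT : TlowK4 l₁ ≤ Q := le_trans (TlowK4_mono (by linarith) hl) hQ
  have hT₁ : (100 : ℝ) ≤ TlowK4 l₁ := TlowK4_ge hl₁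
  have hQpos : 0 < Q := by linarith
  have hF0 : 0 ≤ F := le_trans zero_le_one hF1
  have hC1 : C ≤ ((X : ℝ) ^ 2 + N - 1) * F / Q + B := by
    have : C * Q ≤ (((X : ℝ) ^ 2 + N - 1) * F / Q + B) * Q := by
      rw [add_mul, div_mul_cancel₀ _ hQpos.ne']
      exact hBD
    exact le_of_mul_le_mul_right this hQpos
  have hc2pos : (0 : ℝ) < (c : ℝ) ^ 2 := by positivity
  set K : ℝ := ((c : ℝ) ^ 2 + 1) / (c : ℝ) ^ 2 with hKdef
  have hK0 : 0 < K := by positivity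
  have hC2 : ((X : ℝ) ^ 2 + N - 1) * F / Q ≤ K * (N : ℝ) * F / TlowK4 l₁ := by
    have hnum0 : 0 ≤ K * (N : ℝ) * F := by positivity
    have hXN : (X : ℝ) ^ 2 ≤ (N : ℝ) / (c : ℝ) ^ 2 := by rw [le_div_iff₀ hc2pos]; exact hXR
    have hKN : (X : ℝ) ^ 2 + N - 1 ≤ K * N := by
      have : K * N = N / (c : ℝ) ^ 2 + N := by rw [hKdef]; field_simp; ring
      rw [this]; linarith
    have hnum : ((X : ℝ) ^ 2 + N - 1) * F ≤ K * (N : ℝ) * F := mul_le_mul_of_nonneg_right hKN hF0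
    calc ((X : ℝ) ^ 2 + N - 1) * F / Q ≤ K * (N : ℝ) * F / Q := div_le_div_of_nonneg_right hnum hQpos.le
      _ ≤ K * (N : ℝ) * F / TlowK4 l₁ :=
          div_le_div_of_nonneg_left hnum0 (by linarith) hQT
  -- main term
  have hmain : K * (N : ℝ) * F / TlowK4 l₁ ≤ (A - 0.02) * F * (N : ℝ) / L ^ 2 := by
    have hkey : ((c : ℝ) ^ 2 + 1) * L ^ 2 ≤ (c : ℝ) ^ 2 * (A - 0.02) * TlowK4 l₁ := hA L hL
    have hkey' : K * L ^ 2 ≤ (A - 0.02) * TlowK4 l₁ := by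
      rw [hKdef, div_mul_eq_mul_div, div_le_iff₀ hc2pos]
      linarith [hkey]
    rw [div_le_div_iff₀ (by linarith) hL2pos]
    have hNF : 0 ≤ (N : ℝ) * F := by positivity
    have h := mul_le_mul_of_nonneg_left hkey' hNF
    calc K * (N : ℝ) * F * L ^ 2 = (N : ℝ) * F * (K * L ^ 2) := by ring
      _ ≤ (N : ℝ) * F * ((A - 0.02) * TlowK4 l₁) := h
      _ = (A - 0.02) * F * (N : ℝ) * TlowK4 l₁ := by ring
  -- boundary term
  have htail : B ≤ 0.02 * F * (N : ℝ) / L ^ 2 := by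
    have h2 : (E / 4 + 1) * L ^ 2 ≤ 0.01 * (N : ℝ) := by
      rw [← hE2]; exact tail_numeric'' hL41 hEL
    have h3 : 0.02 * (N : ℝ) ≤ 0.02 * F * (N : ℝ) :=
      calc 0.02 * (N : ℝ) ≤ F * (0.02 * (N : ℝ)) := le_mul_of_one_le_left (by positivity) hF1
        _ = 0.02 * F * (N : ℝ) := by ring
    rw [le_div_iff₀ hL2pos]
    have h1 : B * L ^ 2 ≤ 2 * ((E / 4 + 1) * L ^ 2) := by
      have hEc4 : E / c ≤ E / 4 := div_le_div_of_nonneg_left hE0.le (by norm_num) hcR4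
      have : B ≤ 2 * (E / 4 + 1) := by linarith only [hB, hXhi, hEc4]
      nlinarith only [this, hL2pos]
    linarith only [h1, h2, h3]
  calc C ≤ ((X : ℝ) ^ 2 + N - 1) * F / Q + B := hC1
    _ ≤ K * (N : ℝ) * F / TlowK4 l₁ + B := by linarith only [hC2]
    _ ≤ (A - 0.02) * F * (N : ℝ) / L ^ 2 + 0.02 * F * (N : ℝ) / L ^ 2 := add_le_add hmain htail
    _ = A * F * (N : ℝ) / L ^ 2 := by ring

/-- **Explicit GOLDBACH sieve bound with length `⌊√N⌋/c` on `TlowK4`**: under the numerics of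
`explicit_of_largeSieve_kappa4_c`, `r(N) ≤ A·f(N)·N/log²N` for even `N ≥ e^Λ`. [cite: BatemanDiamond2004, §13.4 (13.13)–(13.14)] -/
theorem goldbachCount_le_of_numeric4_c {c : ℕ} {lc Λ A : ℝ} (hc4 : 4 ≤ c) (hc40 : c ≤ 40)
    (hlc : (c : ℝ) * 1.00012 ≤ Real.exp lc) (hΛ : 60 ≤ Λ) (hΛc : 38.22 + 2 * lc ≤ Λ)
    (hnum : ∀ L : ℝ, Λ ≤ L → ((c : ℝ) ^ 2 + 1) * L ^ 2
        ≤ (c : ℝ) ^ 2 * (A - 0.02) * TlowK4 (L / 2 - lc))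
    {N : ℕ} (hN : Real.exp Λ ≤ (N : ℝ)) (heven : Even N) :
    (SingularSeries.goldbachCount N : ℝ) ≤ A * oddSingularFactor N * (N : ℝ) / Real.log (N : ℝ) ^ 2 := by
  have h41 : Real.exp 41 ≤ (N : ℝ) := (Real.exp_le_exp.mpr (le_trans (by norm_num) hΛ)).trans hN
  have h20 : (2 : ℝ) ^ 20 ≤ (N : ℝ) := le_trans (by norm_num) (two_pow_59_le_exp_41.trans h41)
  have hX1 : 1 ≤ Nat.sqrt N / c := by
    have h20' : 2 ^ 20 ≤ N := by exact_mod_cast h20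
    have hs : 1024 ≤ Nat.sqrt N := by
      rw [Nat.le_sqrt]
      calc 1024 * 1024 = 2 ^ 20 := by norm_num
        _ ≤ N := h20'
    exact (Nat.le_div_iff_mul_le (by omega)).mpr (by omega)
  have hBD := GoldbachSieveEight.goldbachCount_mul_Qsum_le N (Nat.sqrt N / c) heven hX1
  have hprod : (∏ p ∈ (N.primeFactors.filter (2 < ·)), (((p : ℝ) - 1) / ((p : ℝ) - 2)))
      = oddSingularFactor N := rfl
  rw [hprod] at hBD
  exact explicit_of_largeSieve_kappa4_c hc4 hc40 hlc hΛ hΛc hnum hN (one_le_oddSingularFactor' _)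
    (by linarith) hBD



/-! ### §26.2 The pair-sieve step from `e^38` (`c ≤ 16`) on `TlowK4` (round41 §8.2 with `X ≥ 2^22` from `2^54 ≤ e^38`) -/

/-- `2^54 ≤ e^38` as a numeral (`e ≥ 2.718281828`). [folklore] -/
private theorem numeral_le_exp_38 : (18014398509481984 : ℝ) ≤ Real.exp 38 := by
  have he : (2.718281828 : ℝ) ≤ Real.exp 1 := by have := Real.exp_one_gt_d9; linarith
  have h := pow_le_pow_left₀ (by norm_num) he 38
  rw [← Real.exp_nat_mul] at h
  norm_num at h
  exact le_trans (by norm_num) h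

/-- The boundary numerics from `L ≥ 38`: `(E/4 + 1)·L² ≤ 0.01·E²` once `100 L² ≤ E`. [folklore] -/
private theorem tail_numeric38 {L E : ℝ} (hL : 38 ≤ L) (hEL : 100 * L ^ 2 ≤ E) :
    (E / 4 + 1) * L ^ 2 ≤ 0.01 * E ^ 2 := by
  have hL2 : (1444 : ℝ) ≤ L ^ 2 := by nlinarith [hL]
  have hE : (144400 : ℝ) ≤ E := by linarith
  nlinarith [hEL, hE, hL2]


set_option maxHeartbeats 1600000 in
/-- **The enlarged-cell explicit large-sieve step from `e^38`** (ROUND-41; as `explicit_of_largeSieve_kappa2_c40` with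
`Λ ≥ max(38, 35.2 + 2·lc)` and `c ≤ 16`: `√N ≥ (L/2)^12/12! ≥ 4.6·10^6 ≥ 16·262145` at `L ≥ 38`, `TlowK4(l₁) ≥ 88` for
`l₁ ≥ 17.6` (only positivity is used), and the boundary numerics from `L ≥ 38`).
[cite: BatemanDiamond2004, Thm 13.8, §13.4–13.5 pp. 325–328 (explicit form proved here)] -/

theorem explicit_of_largeSieve_kappa4_c38 {c : ℕ} {lc Λ A : ℝ} (hc4 : 4 ≤ c) (hc16 : c ≤ 16)
    (hlc : (c : ℝ) * 1.00012 ≤ Real.exp lc) (hΛ : 38 ≤ Λ) (hΛc : 35.2 + 2 * lc ≤ Λ)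
    (hA : ∀ L : ℝ, Λ ≤ L → ((c : ℝ) ^ 2 + 1) * L ^ 2
        ≤ (c : ℝ) ^ 2 * (A - 0.02) * TlowK4 (L / 2 - lc))
    {N : ℕ} {C F B : ℝ} (hN : Real.exp Λ ≤ (N : ℝ)) (hF1 : 1 ≤ F)
    (hB : B ≤ 2 * ((Nat.sqrt N / c : ℕ) : ℝ) + 2)
    (hBD : C * GoldbachSieveEight.Qsum ∅ (Nat.sqrt N / c) ≤ (((Nat.sqrt N / c : ℕ) : ℝ) ^ 2 + N - 1) * F
      + B * GoldbachSieveEight.Qsum ∅ (Nat.sqrt N / c)) :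
    C ≤ A * F * (N : ℝ) / Real.log (N : ℝ) ^ 2 := by
  have hN0 : (0 : ℝ) < N := lt_of_lt_of_le (Real.exp_pos Λ) hN
  set L := Real.log (N : ℝ) with hLdef
  have hL : Λ ≤ L := by
    have := Real.log_le_log (Real.exp_pos Λ) hN
    rwa [Real.log_exp] at this
  have hL40 : (38 : ℝ) ≤ L := le_trans hΛ hL
  have hL2pos : 0 < L ^ 2 := by positivity
  have hcpos : 0 < c := by omega
  have hc0 : (0 : ℝ) < c := by exact_mod_cast hcpos
  have hcR4 : (4 : ℝ) ≤ c := by exact_mod_cast hc4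
  have hcR32 : (c : ℝ) ≤ 16 := by exact_mod_cast hc16
  -- E = √N = exp(L/2)
  set E := Real.exp (L / 2) with hEdef
  have hE0 : 0 < E := Real.exp_pos _
  have hE2 : E ^ 2 = N := by
    have : E ^ 2 = Real.exp L := by rw [hEdef, sq, ← Real.exp_add]; ring_nf
    rw [this, hLdef, Real.exp_log hN0]
  have hE8 : (L / 2) ^ 8 / 40320 ≤ E := by
    have := Real.pow_div_factorial_le_exp (L / 2) (by linarith) 8
    simpa [Nat.factorial] using this
  have hLsq : (1444 : ℝ) ≤ L ^ 2 := by nlinarith [hL40]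
  have hL4 : (1444 : ℝ) ^ 2 ≤ (L ^ 2) ^ 2 := pow_le_pow_left₀ (by norm_num) hLsq 2
  have hEL : 100 * L ^ 2 ≤ E := by
    have h1 : (1444 : ℝ) ^ 2 * 1444 * L ^ 2 ≤ (L ^ 2) ^ 2 * L ^ 2 * L ^ 2 := by
      have := mul_le_mul hL4 hLsq (by norm_num) (by positivity)
      nlinarith [this, hL2pos]
    have h2 : (L / 2) ^ 8 / 40320 = (L ^ 2) ^ 2 * L ^ 2 * L ^ 2 / 10321920 := by ring
    rw [h2] at hE8
    nlinarith [h1, hE8]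
  have hE12 : (L / 2) ^ 12 / 479001600 ≤ E := by
    have := Real.pow_div_factorial_le_exp (L / 2) (by linarith) 12
    simpa [Nat.factorial] using this
  have hEbig2 : (4600000 : ℝ) ≤ E := by
    have h1 : ((19 : ℝ)) ^ 12 ≤ (L / 2) ^ 12 := pow_le_pow_left₀ (by norm_num) (by linarith) 12
    have h2 : ((19 : ℝ)) ^ 12 / 479001600 ≤ E := le_trans (div_le_div_of_nonneg_right h1 (by norm_num)) hE12
    norm_num at h2
    linarith
  -- s = ⌊√N⌋, X = s / c
  set s := Nat.sqrt N with hsdef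
  set X := s / c with hXdef
  have hs2 : (s : ℝ) ^ 2 ≤ N := by exact_mod_cast Nat.sqrt_le' N
  have hs2' : (N : ℝ) < ((s : ℝ) + 1) ^ 2 := by exact_mod_cast Nat.lt_succ_sqrt' N
  have hsE : (s : ℝ) ≤ E := by
    have : (s : ℝ) ^ 2 ≤ E ^ 2 := by rw [hE2]; exact hs2
    exact (pow_le_pow_iff_left₀ (Nat.cast_nonneg s) hE0.le two_ne_zero).mp this
  have hEs : E < (s : ℝ) + 1 := by
    have : E ^ 2 < ((s : ℝ) + 1) ^ 2 := by rw [hE2]; exact hs2'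
    exact (pow_lt_pow_iff_left₀ hE0.le (by positivity) two_ne_zero).mp this
  have hXc : X * c ≤ s := Nat.div_mul_le_self s c
  have hXc' : s + 1 ≤ X * c + c := Nat.lt_div_mul_add hcpos
  have hXcR : (X : ℝ) * c ≤ s := by exact_mod_cast hXc
  have hXcR' : (s : ℝ) + 1 ≤ (X : ℝ) * c + c := by exact_mod_cast hXc'
  have hX0R : (0 : ℝ) ≤ X := Nat.cast_nonneg X
  have hXR : (X : ℝ) ^ 2 * (c : ℝ) ^ 2 ≤ (N : ℝ) := by
    have : ((X : ℝ) * c) ^ 2 ≤ (s : ℝ) ^ 2 := pow_le_pow_left₀ (by positivity) hXcR 2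
    nlinarith [hs2, this]
  have hXlo : E / c - 1 < (X : ℝ) := by
    have h1 : E < (X : ℝ) * c + c := by linarith [hEs, hXcR']
    rw [sub_lt_iff_lt_add, div_lt_iff₀ hc0]; linarith
  have hXhi : (X : ℝ) ≤ E / c := by
    rw [le_div_iff₀ hc0]; linarith [hsE, hXcR]
  have hEc : (262145 : ℝ) ≤ E / c := by
    rw [le_div_iff₀ hc0]; nlinarith [hEbig2, hcR32]
  have hX0 : (0 : ℝ) < X := by linarith
  have hX4194304 : 4194304 ≤ X := by
    have h54 : ((18014398509481984 : ℕ) : ℝ) ≤ (N : ℝ) := by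
      have := numeral_le_exp_38.trans ((Real.exp_le_exp.mpr hΛ).trans hN)
      exact_mod_cast this
    have h54' : 18014398509481984 ≤ N := by exact_mod_cast h54
    have hs27 : 134217728 ≤ s := by
      rw [hsdef, Nat.le_sqrt]
      calc 134217728 * 134217728 = 18014398509481984 := by norm_num
        _ ≤ N := h54'
    rw [hXdef]
    exact (Nat.le_div_iff_mul_le hcpos).mpr (by
      calc 4194304 * c ≤ 4194304 * 16 := Nat.mul_le_mul_left _ hc16
        _ ≤ s := by omega)
  -- log X ≥ l₁ := L/2 − lc
  set l₁ := L / 2 - lc with hl₁def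
  have hexp : Real.exp l₁ ≤ (X : ℝ) := by
    rw [hl₁def, Real.exp_sub]
    have hlc0 : (0 : ℝ) < (c : ℝ) * 1.00012 := by positivity
    have h1 : E / Real.exp lc ≤ E / ((c : ℝ) * 1.00012) :=
      div_le_div_of_nonneg_left hE0.le hlc0 hlc
    have h2 : E / ((c : ℝ) * 1.00012) ≤ E / c - 1 := by
      rw [show E / ((c : ℝ) * 1.00012) = E / c / 1.00012 by rw [div_div],
        div_le_iff₀ (by norm_num : (0 : ℝ) < 1.00012)]
      linarith [hEc]
    linarith [hXlo]
  have hl : l₁ ≤ Real.log X := by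
    rw [Real.le_log_iff_exp_le hX0]; exact hexp
  have hl₁ : (17.6 : ℝ) ≤ l₁ := by rw [hl₁def]; linarith
  -- Q ≥ TlowK4(log X) ≥ TlowK4(l₁) ≥ 99
  set Q := GoldbachSieveEight.Qsum ∅ X with hQdef
  have hQ : TlowK4 (Real.log X) ≤ Q := Qsum_ge_kappa4 hX4194304
  have hQT : TlowK4 l₁ ≤ Q := le_trans (TlowK4_mono (by linarith) hl) hQ
  have hT₁ : (88 : ℝ) ≤ TlowK4 l₁ := TlowK4_ge88 hl₁
  have hQpos : 0 < Q := by linarith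
  have hF0 : 0 ≤ F := le_trans zero_le_one hF1
  have hC1 : C ≤ ((X : ℝ) ^ 2 + N - 1) * F / Q + B := by
    have : C * Q ≤ (((X : ℝ) ^ 2 + N - 1) * F / Q + B) * Q := by
      rw [add_mul, div_mul_cancel₀ _ hQpos.ne']
      exact hBD
    exact le_of_mul_le_mul_right this hQpos
  have hc2pos : (0 : ℝ) < (c : ℝ) ^ 2 := by positivity
  set K : ℝ := ((c : ℝ) ^ 2 + 1) / (c : ℝ) ^ 2 with hKdef
  have hK0 : 0 < K := by positivity
  have hC2 : ((X : ℝ) ^ 2 + N - 1) * F / Q ≤ K * (N : ℝ) * F / TlowK4 l₁ := by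
    have hnum0 : 0 ≤ K * (N : ℝ) * F := by positivity
    have hXN : (X : ℝ) ^ 2 ≤ (N : ℝ) / (c : ℝ) ^ 2 := by rw [le_div_iff₀ hc2pos]; exact hXR
    have hKN : (X : ℝ) ^ 2 + N - 1 ≤ K * N := by
      have : K * N = N / (c : ℝ) ^ 2 + N := by rw [hKdef]; field_simp; ring
      rw [this]; linarith
    have hnum : ((X : ℝ) ^ 2 + N - 1) * F ≤ K * (N : ℝ) * F := mul_le_mul_of_nonneg_right hKN hF0
    calc ((X : ℝ) ^ 2 + N - 1) * F / Q ≤ K * (N : ℝ) * F / Q := div_le_div_of_nonneg_right hnum hQpos.le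
      _ ≤ K * (N : ℝ) * F / TlowK4 l₁ :=
          div_le_div_of_nonneg_left hnum0 (by linarith) hQT
  -- main term
  have hmain : K * (N : ℝ) * F / TlowK4 l₁ ≤ (A - 0.02) * F * (N : ℝ) / L ^ 2 := by
    have hkey : ((c : ℝ) ^ 2 + 1) * L ^ 2 ≤ (c : ℝ) ^ 2 * (A - 0.02) * TlowK4 l₁ := hA L hL
    have hkey' : K * L ^ 2 ≤ (A - 0.02) * TlowK4 l₁ := by
      rw [hKdef, div_mul_eq_mul_div, div_le_iff₀ hc2pos]
      linarith [hkey]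
    rw [div_le_div_iff₀ (by linarith) hL2pos]
    have hNF : 0 ≤ (N : ℝ) * F := by positivity
    have h := mul_le_mul_of_nonneg_left hkey' hNF
    calc K * (N : ℝ) * F * L ^ 2 = (N : ℝ) * F * (K * L ^ 2) := by ring
      _ ≤ (N : ℝ) * F * ((A - 0.02) * TlowK4 l₁) := h
      _ = (A - 0.02) * F * (N : ℝ) * TlowK4 l₁ := by ring
  -- boundary term
  have htail : B ≤ 0.02 * F * (N : ℝ) / L ^ 2 := by
    have h2 : (E / 4 + 1) * L ^ 2 ≤ 0.01 * (N : ℝ) := by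
      rw [← hE2]; exact tail_numeric38 hL40 hEL
    have h3 : 0.02 * (N : ℝ) ≤ 0.02 * F * (N : ℝ) :=
      calc 0.02 * (N : ℝ) ≤ F * (0.02 * (N : ℝ)) := le_mul_of_one_le_left (by positivity) hF1
        _ = 0.02 * F * (N : ℝ) := by ring
    rw [le_div_iff₀ hL2pos]
    have h1 : B * L ^ 2 ≤ 2 * ((E / 4 + 1) * L ^ 2) := by
      have hEc4 : E / c ≤ E / 4 := div_le_div_of_nonneg_left hE0.le (by norm_num) hcR4
      have : B ≤ 2 * (E / 4 + 1) := by linarith only [hB, hXhi, hEc4]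
      nlinarith only [this, hL2pos]
    linarith only [h1, h2, h3]
  calc C ≤ ((X : ℝ) ^ 2 + N - 1) * F / Q + B := hC1
    _ ≤ K * (N : ℝ) * F / TlowK4 l₁ + B := by linarith only [hC2]
    _ ≤ (A - 0.02) * F * (N : ℝ) / L ^ 2 + 0.02 * F * (N : ℝ) / L ^ 2 := add_le_add hmain htail
    _ = A * F * (N : ℝ) / L ^ 2 := by ring


/-- **Explicit PRIME-PAIR sieve bound with length `⌊√N⌋/c`, from `e^38`**: under the numerics of
`explicit_of_largeSieve_kappa4_c38`, `#{p ≤ N : p + h prime} ≤ A·f(h)·N/log²N` for even `h ≠ 0`, `N ≥ e^Λ`.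
[cite: BatemanDiamond2004, Thm 13.8 (explicit form proved here)] -/

theorem pairCount_le_of_numeric4_c38 {c : ℕ} {lc Λ A : ℝ} (hc4 : 4 ≤ c) (hc16 : c ≤ 16)
    (hlc : (c : ℝ) * 1.00012 ≤ Real.exp lc) (hΛ : 38 ≤ Λ) (hΛc : 35.2 + 2 * lc ≤ Λ)
    (hA : ∀ L : ℝ, Λ ≤ L → ((c : ℝ) ^ 2 + 1) * L ^ 2
        ≤ (c : ℝ) ^ 2 * (A - 0.02) * TlowK4 (L / 2 - lc))
    {N h : ℕ} (hN : Real.exp Λ ≤ (N : ℝ)) (hh : h ≠ 0) (heven : Even h) :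
    ((((Nat.primesLE N).filter fun p => (p + h).Prime).card : ℕ) : ℝ)
      ≤ A * oddSingularFactor h * (N : ℝ) / Real.log (N : ℝ) ^ 2 := by
  have h40 : Real.exp 38 ≤ (N : ℝ) := (Real.exp_le_exp.mpr hΛ).trans hN
  have h20 : (2 : ℝ) ^ 20 ≤ (N : ℝ) := le_trans (by norm_num) (numeral_le_exp_38.trans h40)
  have hX1 : 1 ≤ Nat.sqrt N / c := by
    have h20' : 2 ^ 20 ≤ N := by exact_mod_cast h20
    have hs : 1024 ≤ Nat.sqrt N := by
      rw [Nat.le_sqrt]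
      calc 1024 * 1024 = 2 ^ 20 := by norm_num
        _ ≤ N := h20'
    exact (Nat.le_div_iff_mul_le (by omega)).mpr (by omega)
  have hBD := GoldbachSieveEight.card_primePairs_mul_Qsum_le 1 h N (Nat.sqrt N / c) le_rfl
    (Nat.one_le_iff_ne_zero.mpr hh) (by simpa using heven) hX1
  have hprod : (∏ p ∈ ((1 * h).primeFactors.filter (2 < ·)), (((p : ℝ) - 1) / ((p : ℝ) - 2)))
      = oddSingularFactor h := by rw [one_mul]; rfl
  rw [hprod] at hBD
  have hmain := explicit_of_largeSieve_kappa4_c38 hc4 hc16 hlc hΛ hΛc hA hN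
    (one_le_oddSingularFactor' _) (by linarith) hBD
  have hcount : ((range (N + 1)).filter (fun p => p.Prime ∧ (1 * p + h).Prime)).card
      = ((Nat.primesLE N).filter fun p => (p + h).Prime).card := by
    congr 1
    ext p
    simp only [mem_filter, mem_range, Nat.mem_primesLE, one_mul, Nat.lt_succ_iff]
    tauto
  rw [hcount] at hmain
  exact hmain



/-! ### §26.3 The prime-pair wrapper on `TlowK4` (`Λ ≥ 60`; round41 §8.3 pattern) -/

/-- **Explicit PRIME-PAIR sieve bound with length `⌊√N⌋/c` on `TlowK4`**: under the numerics of
`explicit_of_largeSieve_kappa4_c`, `#{p ≤ N : p + h prime} ≤ A·f(h)·N/log²N` for even `h ≠ 0`, `N ≥ e^Λ`.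
[cite: BatemanDiamond2004, Thm 13.8 (explicit form proved here)] -/

theorem pairCount_le_of_numeric4_c {c : ℕ} {lc Λ A : ℝ} (hc4 : 4 ≤ c) (hc40 : c ≤ 40)
    (hlc : (c : ℝ) * 1.00012 ≤ Real.exp lc) (hΛ : 60 ≤ Λ) (hΛc : 38.22 + 2 * lc ≤ Λ)
    (hA : ∀ L : ℝ, Λ ≤ L → ((c : ℝ) ^ 2 + 1) * L ^ 2
        ≤ (c : ℝ) ^ 2 * (A - 0.02) * TlowK4 (L / 2 - lc))
    {N h : ℕ} (hN : Real.exp Λ ≤ (N : ℝ)) (hh : h ≠ 0) (heven : Even h) :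
    ((((Nat.primesLE N).filter fun p => (p + h).Prime).card : ℕ) : ℝ)
      ≤ A * oddSingularFactor h * (N : ℝ) / Real.log (N : ℝ) ^ 2 := by
  have h41 : Real.exp 41 ≤ (N : ℝ) := (Real.exp_le_exp.mpr (le_trans (by norm_num) hΛ)).trans hN
  have h20 : (2 : ℝ) ^ 20 ≤ (N : ℝ) := le_trans (by norm_num) (two_pow_59_le_exp_41.trans h41)
  have hX1 : 1 ≤ Nat.sqrt N / c := by
    have h20' : 2 ^ 20 ≤ N := by exact_mod_cast h20
    have hs : 1024 ≤ Nat.sqrt N := by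
      rw [Nat.le_sqrt]
      calc 1024 * 1024 = 2 ^ 20 := by norm_num
        _ ≤ N := h20'
    exact (Nat.le_div_iff_mul_le (by omega)).mpr (by omega)
  have hBD := GoldbachSieveEight.card_primePairs_mul_Qsum_le 1 h N (Nat.sqrt N / c) le_rfl
    (Nat.one_le_iff_ne_zero.mpr hh) (by simpa using heven) hX1
  have hprod : (∏ p ∈ ((1 * h).primeFactors.filter (2 < ·)), (((p : ℝ) - 1) / ((p : ℝ) - 2)))
      = oddSingularFactor h := by rw [one_mul]; rfl
  rw [hprod] at hBD
  have hmain := explicit_of_largeSieve_kappa4_c hc4 hc40 hlc hΛ hΛc hA hN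
    (one_le_oddSingularFactor' _) (by linarith) hBD
  have hcount : ((range (N + 1)).filter (fun p => p.Prime ∧ (1 * p + h).Prime)).card
      = ((Nat.primesLE N).filter fun p => (p + h).Prime).card := by
    congr 1
    ext p
    simp only [mem_filter, mem_range, Nat.mem_primesLE, one_mul, Nat.lt_succ_iff]
    tauto
  rw [hcount] at hmain
  exact hmain



/-! ### §26.4 Numerics and instances on `TlowK4`: pair sieves `13.01` (`e^38`, `c = 4`), `11.84` (`e^109`, `c = 8`),
`11.52` (`e^190`, `c = 8`); Goldbach sieve `11.33` (`e^314`, `c = 16`) -/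

/-- `c = 4` numerics at `Λ = 38` on `TlowK4`: `17L² ≤ 16·12.99·TlowK4(L/2 − 1.3865)` for `L ≥ 38`. [folklore] -/
private theorem cells4_numeric4_38 {L : ℝ} (hL : 38 ≤ L) :
    (((4 : ℕ) : ℝ) ^ 2 + 1) * L ^ 2 ≤ ((4 : ℕ) : ℝ) ^ 2 * (13.01 - 0.02) * TlowK4 (L / 2 - 1.3865) := by
  unfold TlowK4
  push_cast
  nlinarith [hL, mul_self_nonneg (L - 38)]

/-- **PAIR SIEVE `13.01` above `e^38`** (`c = 4`, the 68 cells with the harmonic constant; ROUND-41: `17.45`).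
[cite: BatemanDiamond2004, Thm 13.8, §13.4–13.5 pp. 325–328 (explicit form proved here)] -/
theorem pairCount_le_1301 {N h : ℕ} (hN : Real.exp 38 ≤ (N : ℝ)) (hh : h ≠ 0) (heven : Even h) :
    ((((Nat.primesLE N).filter fun p => (p + h).Prime).card : ℕ) : ℝ)
      ≤ 13.01 * oddSingularFactor h * (N : ℝ) / Real.log (N : ℝ) ^ 2 :=
  pairCount_le_of_numeric4_c38 (c := 4) (lc := 1.3865) (by norm_num) (by norm_num)
    (by have := exp_13865_ge; push_cast; linarith) (by norm_num) (by norm_num)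
    (fun _ hL => cells4_numeric4_38 hL) hN hh heven

/-- `c = 8` numerics at `Λ = 109` on `TlowK4`: `65L² ≤ 64·11.82·TlowK4(L/2 − 2.0796)` for `L ≥ 109`. [folklore] -/
private theorem cells8_numeric4_109 {L : ℝ} (hL : 109 ≤ L) :
    (((8 : ℕ) : ℝ) ^ 2 + 1) * L ^ 2 ≤ ((8 : ℕ) : ℝ) ^ 2 * (11.84 - 0.02) * TlowK4 (L / 2 - 2.0796) := by
  unfold TlowK4
  push_cast
  nlinarith [hL, mul_self_nonneg (L - 109)]

/-- `c = 8` numerics at `Λ = 190` on `TlowK4`: `65L² ≤ 64·11.50·TlowK4(L/2 − 2.0796)` for `L ≥ 190`. [folklore] -/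
private theorem cells8_numeric4_190 {L : ℝ} (hL : 190 ≤ L) :
    (((8 : ℕ) : ℝ) ^ 2 + 1) * L ^ 2 ≤ ((8 : ℕ) : ℝ) ^ 2 * (11.52 - 0.02) * TlowK4 (L / 2 - 2.0796) := by
  unfold TlowK4
  push_cast
  nlinarith [hL, mul_self_nonneg (L - 190)]

/-- **PAIR SIEVE `11.84` above `e^109`** (`c = 8`, 68 cells, harmonic constant; ROUND-41: `13.06`).
[cite: BatemanDiamond2004, Thm 13.8, §13.4–13.5 pp. 325–328 (explicit form proved here)] -/
theorem pairCount_le_1184 {N h : ℕ} (hN : Real.exp 109 ≤ (N : ℝ)) (hh : h ≠ 0) (heven : Even h) :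
    ((((Nat.primesLE N).filter fun p => (p + h).Prime).card : ℕ) : ℝ)
      ≤ 11.84 * oddSingularFactor h * (N : ℝ) / Real.log (N : ℝ) ^ 2 :=
  pairCount_le_of_numeric4_c (c := 8) (lc := 2.0796) (by norm_num) (by norm_num)
    (by have := exp_20796_ge; push_cast; linarith) (by norm_num) (by norm_num)
    (fun _ hL => cells8_numeric4_109 hL) hN hh heven

/-- **PAIR SIEVE `11.52` above `e^190`** (`c = 8`, 68 cells, harmonic constant; ROUND-41: `12.19`).
[cite: BatemanDiamond2004, Thm 13.8, §13.4–13.5 pp. 325–328 (explicit form proved here)] -/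
theorem pairCount_le_1152 {N h : ℕ} (hN : Real.exp 190 ≤ (N : ℝ)) (hh : h ≠ 0) (heven : Even h) :
    ((((Nat.primesLE N).filter fun p => (p + h).Prime).card : ℕ) : ℝ)
      ≤ 11.52 * oddSingularFactor h * (N : ℝ) / Real.log (N : ℝ) ^ 2 :=
  pairCount_le_of_numeric4_c (c := 8) (lc := 2.0796) (by norm_num) (by norm_num)
    (by have := exp_20796_ge; push_cast; linarith) (by norm_num) (by norm_num)
    (fun _ hL => cells8_numeric4_190 hL) hN hh heven

/-- `c = 16` numerics at `Λ = 314` on `TlowK4`: `257L² ≤ 256·11.31·TlowK4(L/2 − 2.7728)` for `L ≥ 314`. [folklore] -/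
private theorem cells16_numeric4_314 {L : ℝ} (hL : 314 ≤ L) :
    (((16 : ℕ) : ℝ) ^ 2 + 1) * L ^ 2 ≤ ((16 : ℕ) : ℝ) ^ 2 * (11.33 - 0.02) * TlowK4 (L / 2 - 2.7728) := by
  unfold TlowK4
  push_cast
  nlinarith [hL, mul_self_nonneg (L - 314)]

/-- **GOLDBACH SIEVE `11.33` above `e^314`** (`c = 16`, 68 cells, harmonic constant; ROUND-41: `11.70` from `e^327`):
`r(N) ≤ 11.33·f(N)·N/log²N` for even `N ≥ e^314`. [cite: BatemanDiamond2004, §13.4 (13.13)–(13.14)] -/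
theorem goldbachCount_le_1133 {N : ℕ} (hN : Real.exp 314 ≤ (N : ℝ)) (heven : Even N) :
    (SingularSeries.goldbachCount N : ℝ) ≤ 11.33 * oddSingularFactor N * (N : ℝ) / Real.log (N : ℝ) ^ 2 :=
  goldbachCount_le_of_numeric4_c (c := 16) (lc := 2.7728) (by norm_num) (by norm_num)
    (by have := exp_27728_ge; push_cast; linarith) (by norm_num) (by norm_num)
    (fun _ hL => cells16_numeric4_314 hL) hN heven

/-! ### §26.5  The unconditional five-regime glue from `L₁ ≥ 38` with `h ≥ 21` (round41 §7.4 with the thresholds `38/109/190`,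
pair constants `13.01/11.84/11.52` and weights `78.06/182.14/664.7/2233`) -/

set_option maxHeartbeats 4000000 in
/-- **UNCONDITIONAL GLUE FOR ALL `y ≥ 1`, FIVE REGIMES, `h ≥ 21`, `L₁ ≥ 38`** (ROUND-42 «HARMONIC»; round41 §7.4 with the new thresholds, pair constants and weights): one shift below `e^{L₁}`
(`L₁ ≤ 1.8424h`, `π(n) ≥ 0.9212 n/log n` above `10⁶`, `(n+2)/20 ≤ π(n)` on `[122, 10⁶)` — NEW, `primeCounting_ge_div20` —
and `π ≥ 2` below), THREE shifts `{3,5,7}` on `(e^{L₁}, e^{Lt}]` (`three_shift_count`, pair weight `2·13.01·3 = 78.06`,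
the `e^38` pair sieve `pairCount_le_1301`, Sylvester counts `0.93919·(2y−q)/L`), FOUR shifts on `(e^{Lt}, e^{L₂}]`
(weight `182.14`), SEVEN shifts on `(e^{L₂}, e^{L₃}]` (`pairCount_le_1184` from `e^109`, weight `249232/375 ≤ 664.7`), TWELVE
shifts on `(e^{L₃}, e^{Λ₀})` (`pairCount_le_1152` from `e^190`, weight `93923136/42075 ≤ 2233`), the count above `e^{Λ₀}`:
`L² + h ≤ h·(5.63514L − 78.06)` on `[L₁, Lt]`, `L² + h ≤ h·(7.51352L − 182.14)` on `[Lt, L₂]`,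
`L² + h ≤ h·(13.14866L − 664.7)` on `[L₂, L₃]`, `L² + h ≤ h·(22.54056L − 2233)` on `[L₃, Λ₀]`; requires `L₁ ≥ 38`. [cite: Nathanson1996, Theorem 7.8 (five-regime explicit form for the halved Goldbach set; proved here)] -/
theorem half_count_ge_allN_three38 {L₁ Lt L₂ L₃ Λ₀ : ℝ} {h : ℕ} (h21 : 21 ≤ h) (h38 : 38 ≤ L₁) (hL₁h : L₁ ≤ 1.8424 * h)
    (hL₂ : 109 ≤ L₂) (hL₃ : 190 ≤ L₃) (hΛ4 : Λ₀ ≤ 10000)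
    (hquad3 : ∀ L : ℝ, L₁ ≤ L → L ≤ Lt → L ^ 2 + h ≤ h * (5.63514 * L - 78.06))
    (hquad : ∀ L : ℝ, Lt ≤ L → L ≤ L₂ → L ^ 2 + h ≤ h * (7.51352 * L - 182.14))
    (hquad7 : ∀ L : ℝ, L₂ ≤ L → L ≤ L₃ → L ^ 2 + h ≤ h * (13.14866 * L - 664.7))
    (hquad12 : ∀ L : ℝ, L₃ ≤ L → L ≤ Λ₀ → L ^ 2 + h ≤ h * (22.54056 * L - 2233))
    (hlarge : ∀ x : ℕ, Real.exp Λ₀ ≤ (x : ℝ) →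
      (x : ℝ) / (2 * h) ≤ #{N ∈ Ioc 0 x | Even N ∧ ∃ p q : ℕ, p.Prime ∧ q.Prime ∧ p + q = N})
    {y : ℕ} (hy : 1 ≤ y) :
    (y : ℝ) / h ≤ #{b ∈ Ioc 0 y | b ∈ (({0, 1} : Set ℕ) ∪ {m | ∃ p q : ℕ, p.Prime ∧ q.Prime ∧ p + q = 2 * m})} := by
  set B : Set ℕ := ({0, 1} : Set ℕ) ∪ {m | ∃ p q : ℕ, p.Prime ∧ q.Prime ∧ p + q = 2 * m} with hB
  have hhr : (21 : ℝ) ≤ h := by exact_mod_cast h21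
  have hh0 : (0 : ℝ) < h := by linarith
  have hL₁pos : (0 : ℝ) < L₁ := by linarith
  by_cases hbig : Real.exp Λ₀ ≤ ((2 * y : ℕ) : ℝ)
  · have h1 := hlarge (2 * y) hbig
    have h2 := even_goldbach_card_le_half y
    have e : ((2 * y : ℕ) : ℝ) / (2 * h) = (y : ℝ) / h := by
      push_cast
      field_simp
    rw [e] at h1
    exact h1.trans (by exact_mod_cast h2)
  rw [not_le] at hbig
  by_cases hsmall : y ≤ h
  · have h1 : 1 ≤ #{b ∈ Ioc 0 y | b ∈ B} :=
      card_pos.mpr ⟨1, by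
        rw [mem_filter, mem_Ioc]
        exact ⟨⟨by omega, hy⟩, Or.inl (by simp)⟩⟩
    have h1' : (1 : ℝ) ≤ #{b ∈ Ioc 0 y | b ∈ B} := by exact_mod_cast h1
    have h2 : (y : ℝ) / h ≤ 1 := by
      rw [div_le_one hh0]
      exact_mod_cast hsmall
    linarith
  rw [not_le] at hsmall
  have hy29 : 22 ≤ y := by omega
  have hnr : ((2 * y - 3 : ℕ) : ℝ) = 2 * (y : ℝ) - 3 := cast_two_mul_sub_three (by omega)
  have hy29r : (22 : ℝ) ≤ y := by exact_mod_cast hy29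
  have hy0 : (0 : ℝ) < y := by linarith
  have hn55 : 41 ≤ 2 * y - 3 := by omega
  have hn0 : (0 : ℝ) < ((2 * y - 3 : ℕ) : ℝ) := by rw [hnr]; linarith
  have hn1 : (1 : ℝ) < ((2 * y - 3 : ℕ) : ℝ) := by rw [hnr]; linarith
  have hlogpos : 0 < Real.log ((2 * y - 3 : ℕ) : ℝ) := Real.log_pos hn1
  by_cases hmid : Real.log ((2 * y - 3 : ℕ) : ℝ) ≤ L₁
  · -- ONE SHIFT below `e^{L₁}` (§15)
    have hemb := primeCounting_shift_le_half_count (y := y) (by omega)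
    have hembr : (Nat.primeCounting (2 * y - 3) : ℝ) + 1 ≤ #{b ∈ Ioc 0 y | b ∈ B} := by exact_mod_cast hemb
    refine le_trans ?_ hembr
    by_cases h6 : 10 ^ 6 ≤ 2 * y - 3
    · have hπ : 0.9212 * ((2 * y - 3 : ℕ) : ℝ) / Real.log ((2 * y - 3 : ℕ) : ℝ)
          ≤ (Nat.primeCounting (2 * y - 3) : ℝ) := by
        have := primeCountingLowerMul_09212
        unfold PrimeCountingLowerMul at this
        exact this (2 * y - 3) h6
      have h2 : 0.9212 * ((2 * y - 3 : ℕ) : ℝ) / L₁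
          ≤ 0.9212 * ((2 * y - 3 : ℕ) : ℝ) / Real.log ((2 * y - 3 : ℕ) : ℝ) :=
        div_le_div_of_nonneg_left (by positivity) hlogpos hmid
      have h3 : (y : ℝ) / h ≤ 1.8424 * y / L₁ := by
        rw [div_le_div_iff₀ hh0 hL₁pos]
        nlinarith [mul_le_mul_of_nonneg_left hL₁h hy0.le]
      have h4 : 1.8424 * (y : ℝ) / L₁ ≤ 0.9212 * ((2 * y - 3 : ℕ) : ℝ) / L₁ + 1 := by
        rw [hnr]
        have e : 0.9212 * (2 * (y : ℝ) - 3) / L₁ = 1.8424 * y / L₁ - 2.7636 / L₁ := by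
          field_simp
          ring
        rw [e]
        have : 2.7636 / L₁ ≤ 1 := by
          rw [div_le_one hL₁pos]
          linarith
        linarith
      linarith [h2, h3, h4, hπ]
    · rw [not_le] at h6
      -- `2y − 3 < 10⁶`: Chebyshev pointwise `(n + 2)/20 ≤ π(n)` for `n ≥ 122` (§7.3), `π(n) ≥ π(3) = 2` below
      by_cases h88 : 122 ≤ 2 * y - 3
      · have hlog14 : Real.log ((2 * y - 3 : ℕ) : ℝ) ≤ 14 := log_le_14_of_lt (by omega) h6
        have hπ := primeCounting_ge_div20 h88 hlog14
        rw [hnr] at hπ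
        have h6' : (y : ℝ) / h ≤ (y : ℝ) / 21 := div_le_div_of_nonneg_left hy0.le (by norm_num) hhr
        have h7 : (y : ℝ) / 21 ≤ (2 * (y : ℝ) - 3 + 2) / 20 + 1 := by
          rw [div_le_iff₀ (by norm_num : (0 : ℝ) < 21)]
          linarith
        linarith [hπ, h6', h7]
      · rw [not_le] at h88
        have hπ3 : Nat.primeCounting 3 = 2 := by decide
        have hmono := Nat.monotone_primeCounting (show 3 ≤ 2 * y - 3 by omega)
        rw [hπ3] at hmono
        have hπ2 : (2 : ℝ) ≤ (Nat.primeCounting (2 * y - 3) : ℝ) := by exact_mod_cast hmono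
        have hy45 : (y : ℝ) ≤ 62 := by exact_mod_cast (show y ≤ 62 by omega)
        have h7 : (y : ℝ) / h ≤ 3 := by
          rw [div_le_iff₀ hh0]
          linarith
        linarith
  · -- SHIFTS on `(e^{L₁}, e^{Λ₀})`: three / four / seven / twelve
    rw [not_le] at hmid
    have h59 : (18014398509481984 : ℝ) < ((2 * y - 3 : ℕ) : ℝ) := by
      have h1 : Real.exp L₁ < ((2 * y - 3 : ℕ) : ℝ) := by
        by_contra hc
        rw [not_lt] at hc
        have := Real.log_le_log hn0 hc
        rw [Real.log_exp] at this
        linarith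
      exact lt_of_le_of_lt (numeral_le_exp_38.trans (Real.exp_le_exp.mpr h38)) h1
    have h59n : 18014398509481984 < 2 * y - 3 := by exact_mod_cast h59
    have hy58 : (9007199254740992 : ℝ) ≤ (y : ℝ) := by
      have : 9007199254740992 ≤ y := by omega
      exact_mod_cast this
    have h2y0 : (0 : ℝ) < ((2 * y : ℕ) : ℝ) := by push_cast; linarith
    set L := Real.log ((2 * y : ℕ) : ℝ) with hLdef
    have hLΛ : L < Λ₀ := by
      have := Real.log_lt_log h2y0 hbig
      rwa [Real.log_exp] at this
    have hL₁L : L₁ ≤ L := by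
      have h2y : ((2 * y - 3 : ℕ) : ℝ) ≤ ((2 * y : ℕ) : ℝ) := by rw [hnr]; push_cast; linarith
      exact (hmid.trans_le (Real.log_le_log hn0 h2y)).le
    have hL40 : (38 : ℝ) ≤ L := h38.trans hL₁L
    have hLpos : (0 : ℝ) < L := by linarith
    have hL4 : L ≤ 10000 := by linarith
    have he40 : Real.exp 38 ≤ ((2 * y : ℕ) : ℝ) := by
      have : Real.exp 38 ≤ Real.exp L := Real.exp_le_exp.mpr hL40
      rwa [hLdef, Real.exp_log h2y0] at this
    -- the prime counts, Sylvester's constant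
    have hπ : ∀ q : ℕ, q ≤ 41 → 0.93919 * (2 * (y : ℝ) - q) / L ≤ (Nat.primeCounting (2 * y - q) : ℝ) := by
      intro q hq
      have hqr : (q : ℝ) ≤ 41 := by exact_mod_cast hq
      have hnq : ((2 * y - q : ℕ) : ℝ) = 2 * (y : ℝ) - q := cast_two_mul_sub (by omega)
      have h6 : 10 ^ 12 ≤ 2 * y - q := by omega
      have hnq0 : (0 : ℝ) < ((2 * y - q : ℕ) : ℝ) := by rw [hnq]; linarith
      have hnq1 : (1 : ℝ) < ((2 * y - q : ℕ) : ℝ) := by rw [hnq]; linarith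
      have h1 : 0.93919 * ((2 * y - q : ℕ) : ℝ) / Real.log ((2 * y - q : ℕ) : ℝ)
          ≤ (Nat.primeCounting (2 * y - q) : ℝ) := by
        have := primeCountingLowerMul_sylvester
        unfold PrimeCountingLowerMul at this
        exact this (2 * y - q) h6
      have hlogq0 : 0 < Real.log ((2 * y - q : ℕ) : ℝ) := Real.log_pos hnq1
      have hlogq : Real.log ((2 * y - q : ℕ) : ℝ) ≤ L := by
        have h2y : ((2 * y - q : ℕ) : ℝ) ≤ ((2 * y : ℕ) : ℝ) := by
          rw [hnq]; push_cast; linarith [Nat.cast_nonneg (α := ℝ) q]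
        exact Real.log_le_log hnq0 h2y
      have h2 : 0.93919 * (2 * (y : ℝ) - q) / L
          ≤ 0.93919 * ((2 * y - q : ℕ) : ℝ) / Real.log ((2 * y - q : ℕ) : ℝ) := by
        rw [← hnq]
        exact div_le_div_of_nonneg_left (by positivity) hlogq0 hlogq
      linarith
    -- the pair counts (the 68-cell pair sieve with the harmonic constant above `e^38`, ROUND-42)
    have hP : ∀ d : ℕ, d ≠ 0 → Even d →
        (#((Nat.primesLE (2 * y)).filter (fun p => (p + d).Prime)) : ℝ)
          ≤ 13.01 * oddSingularFactor d * ((2 * y : ℕ) : ℝ) / L ^ 2 := by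
      intro d hd hde
      exact pairCount_le_1301 (N := 2 * y) (h := d) he40 hd hde
    rcases le_or_gt L Lt with hmidt | hmidt
    · -- THREE SHIFTS `{3, 5, 7}` on `(e^{L₁}, e^{Lt}]`
      have hq := hquad3 L hL₁L hmidt
      have hP2 := hP 2 (by norm_num) (by norm_num)
      have hP4 := hP 4 (by norm_num) (by norm_num)
      rw [oddSingularFactor_two'] at hP2
      rw [oddSingularFactor_four] at hP4
      have hcomb := three_shift_count (y := y) (by omega)
      have hcombr : (Nat.primeCounting (2 * y - 3) : ℝ) + Nat.primeCounting (2 * y - 5)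
          + Nat.primeCounting (2 * y - 7)
          ≤ (#{b ∈ Ioc 0 y | b ∈ B} : ℝ) + 2
            + (2 * #((Nat.primesLE (2 * y)).filter (fun p => (p + 2).Prime))
              + #((Nat.primesLE (2 * y)).filter (fun p => (p + 4).Prime))) := by
        exact_mod_cast hcomb
      have hπ3 := hπ 3 (by norm_num)
      have hπ5 := hπ 5 (by norm_num)
      have hπ7 := hπ 7 (by norm_num)
      push_cast at hπ3 hπ5 hπ7
      have h2yr : ((2 * y : ℕ) : ℝ) = 2 * (y : ℝ) := by push_cast; ring
      rw [h2yr] at hP2 hP4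
      set G : ℝ := (#{b ∈ Ioc 0 y | b ∈ B} : ℝ) with hG
      set Y : ℝ := (y : ℝ) with hY
      -- `G ≥ (5.63514 Y − 14.08785)/L − 2 − 78.06 Y/L²`
      have hG1 : (5.63514 * Y - 14.08785) / L - 2 - 78.06 * Y / L ^ 2 ≤ G := by
        have e1 : (5.63514 * Y - 14.08785) / L = 0.93919 * (2 * Y - 3) / L + 0.93919 * (2 * Y - 5) / L
            + 0.93919 * (2 * Y - 7) / L := by
          field_simp
          ring
        have e2 : 78.06 * Y / L ^ 2 = 2 * (13.01 * 1 * (2 * Y) / L ^ 2) + 13.01 * 1 * (2 * Y) / L ^ 2 := by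
          field_simp
          ring
        rw [e1, e2]
        linarith [hcombr, hπ3, hπ5, hπ7, hP2, hP4]
      have hL2 : (0 : ℝ) < L ^ 2 := by positivity
      have hkey : Y * L ^ 2 ≤ (h : ℝ) * G * L ^ 2 := by
        have e3 : ((5.63514 * Y - 14.08785) / L - 2 - 78.06 * Y / L ^ 2) * L ^ 2
            = 5.63514 * Y * L - 14.08785 * L - 2 * L ^ 2 - 78.06 * Y := by
          field_simp
        have h1 : (5.63514 * Y * L - 14.08785 * L - 2 * L ^ 2 - 78.06 * Y) * h ≤ G * L ^ 2 * h := by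
          rw [← e3]
          exact mul_le_mul_of_nonneg_right (mul_le_mul_of_nonneg_right hG1 hL2.le) hh0.le
        have h2 : Y * (L ^ 2 + h) ≤ Y * (h * (5.63514 * L - 78.06)) :=
          mul_le_mul_of_nonneg_left hq (by linarith)
        have h3 : 14.08785 * L + 2 * L ^ 2 ≤ Y := by
          nlinarith [mul_nonneg (sub_nonneg.2 hL4) hLpos.le]
        have h3' : (h : ℝ) * (14.08785 * L + 2 * L ^ 2) ≤ h * Y := mul_le_mul_of_nonneg_left h3 hh0.le
        nlinarith [h1, h2, h3']
      have hfin := le_of_mul_le_mul_right hkey hL2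
      rw [div_le_iff₀ hh0, mul_comm]
      exact hfin
    · rcases le_or_gt L L₂ with hmid2 | hmid2
      · -- FOUR SHIFTS on `(e^{Lt}, e^{L₂}]`
        have hq := hquad L hmidt.le hmid2
        have hP2 := hP 2 (by norm_num) (by norm_num)
        have hP4 := hP 4 (by norm_num) (by norm_num)
        have hP6 := hP 6 (by norm_num) (by norm_num)
        have hP8 := hP 8 (by norm_num) (by norm_num)
        rw [oddSingularFactor_two'] at hP2
        rw [oddSingularFactor_four] at hP4
        rw [oddSingularFactor_six] at hP6
        rw [oddSingularFactor_eight] at hP8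
        -- combinatorics
        have hcomb := four_shift_count (y := y) (by omega)
        have hcombr : (Nat.primeCounting (2 * y - 3) : ℝ) + Nat.primeCounting (2 * y - 5)
            + Nat.primeCounting (2 * y - 7) + Nat.primeCounting (2 * y - 11)
            ≤ (#{b ∈ Ioc 0 y | b ∈ B} : ℝ) + 2
              + (2 * #((Nat.primesLE (2 * y)).filter (fun p => (p + 2).Prime))
                + 2 * #((Nat.primesLE (2 * y)).filter (fun p => (p + 4).Prime))
                + #((Nat.primesLE (2 * y)).filter (fun p => (p + 8).Prime))
                + #((Nat.primesLE (2 * y)).filter (fun p => (p + 6).Prime))) := by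
          exact_mod_cast hcomb
        have hπ3 := hπ 3 (by norm_num)
        have hπ5 := hπ 5 (by norm_num)
        have hπ7 := hπ 7 (by norm_num)
        have hπ11 := hπ 11 (by norm_num)
        push_cast at hπ3 hπ5 hπ7 hπ11
        have h2yr : ((2 * y : ℕ) : ℝ) = 2 * (y : ℝ) := by push_cast; ring
        rw [h2yr] at hP2 hP4 hP6 hP8
        set G : ℝ := (#{b ∈ Ioc 0 y | b ∈ B} : ℝ) with hG
        set Y : ℝ := (y : ℝ) with hY
        -- `G ≥ (7.51352 Y − 24.41894)/L − 2 − 182.14 Y/L²`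
        have hG1 : (7.51352 * Y - 24.41894) / L - 2 - 182.14 * Y / L ^ 2 ≤ G := by
          have e1 : (7.51352 * Y - 24.41894) / L = 0.93919 * (2 * Y - 3) / L + 0.93919 * (2 * Y - 5) / L
              + 0.93919 * (2 * Y - 7) / L + 0.93919 * (2 * Y - 11) / L := by
            field_simp
            ring
          have e2 : 182.14 * Y / L ^ 2 = 2 * (13.01 * 1 * (2 * Y) / L ^ 2) + 2 * (13.01 * 1 * (2 * Y) / L ^ 2)
              + 13.01 * 1 * (2 * Y) / L ^ 2 + 13.01 * 2 * (2 * Y) / L ^ 2 := by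
            field_simp
            ring
          rw [e1, e2]
          linarith [hcombr, hπ3, hπ5, hπ7, hπ11, hP2, hP4, hP6, hP8]
        have hL2 : (0 : ℝ) < L ^ 2 := by positivity
        have hkey : Y * L ^ 2 ≤ (h : ℝ) * G * L ^ 2 := by
          have e3 : ((7.51352 * Y - 24.41894) / L - 2 - 182.14 * Y / L ^ 2) * L ^ 2
              = 7.51352 * Y * L - 24.41894 * L - 2 * L ^ 2 - 182.14 * Y := by
            field_simp
          have h1 : (7.51352 * Y * L - 24.41894 * L - 2 * L ^ 2 - 182.14 * Y) * h ≤ G * L ^ 2 * h := by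
            rw [← e3]
            exact mul_le_mul_of_nonneg_right (mul_le_mul_of_nonneg_right hG1 hL2.le) hh0.le
          have h2 : Y * (L ^ 2 + h) ≤ Y * (h * (7.51352 * L - 182.14)) :=
            mul_le_mul_of_nonneg_left hq (by linarith)
          have h3 : 24.41894 * L + 2 * L ^ 2 ≤ Y := by
            nlinarith [mul_nonneg (sub_nonneg.2 hL4) hLpos.le]
          have h3' : (h : ℝ) * (24.41894 * L + 2 * L ^ 2) ≤ h * Y := mul_le_mul_of_nonneg_left h3 hh0.le
          nlinarith [h1, h2, h3']
        have hfin := le_of_mul_le_mul_right hkey hL2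
        rw [div_le_iff₀ hh0, mul_comm]
        exact hfin
      · rcases le_or_gt L L₃ with hmid3 | hmid3
        · -- SEVEN SHIFTS on `(e^{L₂}, e^{L₃}]`
          have hq := hquad7 L hmid2.le hmid3
          have he109 : Real.exp 109 ≤ ((2 * y : ℕ) : ℝ) := by
            have : Real.exp 109 ≤ Real.exp L := Real.exp_le_exp.mpr (hL₂.trans hmid2.le)
            rwa [hLdef, Real.exp_log h2y0] at this
          have hP7 : ∀ d : ℕ, d ≠ 0 → Even d →
              (#((Nat.primesLE (2 * y)).filter (fun p => (p + d).Prime)) : ℝ)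
                ≤ 11.84 * oddSingularFactor d * ((2 * y : ℕ) : ℝ) / L ^ 2 := by
            intro d hd hde
            rw [hLdef]
            exact pairCount_le_1184 (N := 2 * y) (h := d) he109 hd hde
          have hP2 := hP7 2 (by norm_num) (by norm_num)
          have hP4 := hP7 4 (by norm_num) (by norm_num)
          have hP6 := hP7 6 (by norm_num) (by norm_num)
          have hP8 := hP7 8 (by norm_num) (by norm_num)
          have hP10 := hP7 10 (by norm_num) (by norm_num)
          have hP12 := hP7 12 (by norm_num) (by norm_num)
          have hP14 := hP7 14 (by norm_num) (by norm_num)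
          have hP16 := hP7 16 (by norm_num) (by norm_num)
          rw [oddSingularFactor_two'] at hP2
          rw [oddSingularFactor_four] at hP4
          rw [oddSingularFactor_six] at hP6
          rw [oddSingularFactor_eight] at hP8
          rw [oddSingularFactor_ten] at hP10
          rw [oddSingularFactor_twelve] at hP12
          rw [oddSingularFactor_fourteen] at hP14
          rw [oddSingularFactor_sixteen] at hP16
          have hcomb := seven_shift_count (y := y) (by omega)
          have hcombr : (Nat.primeCounting (2 * y - 3) : ℝ) + Nat.primeCounting (2 * y - 5)
              + Nat.primeCounting (2 * y - 7) + Nat.primeCounting (2 * y - 11) + Nat.primeCounting (2 * y - 13)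
              + Nat.primeCounting (2 * y - 17) + Nat.primeCounting (2 * y - 19)
              ≤ (#{b ∈ Ioc 0 y | b ∈ B} : ℝ) + 5
                + (4 * #((Nat.primesLE (2 * y)).filter (fun p => (p + 2).Prime))
                  + 3 * #((Nat.primesLE (2 * y)).filter (fun p => (p + 4).Prime))
                  + 4 * #((Nat.primesLE (2 * y)).filter (fun p => (p + 6).Prime))
                  + 3 * #((Nat.primesLE (2 * y)).filter (fun p => (p + 8).Prime))
                  + 2 * #((Nat.primesLE (2 * y)).filter (fun p => (p + 10).Prime))
                  + 2 * #((Nat.primesLE (2 * y)).filter (fun p => (p + 12).Prime))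
                  + 2 * #((Nat.primesLE (2 * y)).filter (fun p => (p + 14).Prime))
                  + #((Nat.primesLE (2 * y)).filter (fun p => (p + 16).Prime))) := by
            exact_mod_cast hcomb
          have hπ3 := hπ 3 (by norm_num)
          have hπ5 := hπ 5 (by norm_num)
          have hπ7 := hπ 7 (by norm_num)
          have hπ11 := hπ 11 (by norm_num)
          have hπ13 := hπ 13 (by norm_num)
          have hπ17 := hπ 17 (by norm_num)
          have hπ19 := hπ 19 (by norm_num)
          push_cast at hπ3 hπ5 hπ7 hπ11 hπ13 hπ17 hπ19
          have h2yr : ((2 * y : ℕ) : ℝ) = 2 * (y : ℝ) := by push_cast; ring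
          rw [h2yr] at hP2 hP4 hP6 hP8 hP10 hP12 hP14 hP16
          set G : ℝ := (#{b ∈ Ioc 0 y | b ∈ B} : ℝ) with hG
          set Y : ℝ := (y : ℝ) with hY
          have hY0 : 0 ≤ Y := le_trans (by norm_num) hy58
          have hL2 : (0 : ℝ) < L ^ 2 := by positivity
          have hG1 : (13.14866 * Y - 70.43925) / L - 5 - 664.7 * Y / L ^ 2 ≤ G := by
            have e1 : (13.14866 * Y - 70.43925) / L
                = 0.93919 * (2 * Y - 3) / L + 0.93919 * (2 * Y - 5) / L + 0.93919 * (2 * Y - 7) / L + 0.93919 * (2 * Y - 11) / L + 0.93919 * (2 * Y - 13) / L + 0.93919 * (2 * Y - 17) / L + 0.93919 * (2 * Y - 19) / L := by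
              field_simp
              ring
            have e2 : 4 * (11.84 * 1 * (2 * Y) / L ^ 2) + 3 * (11.84 * 1 * (2 * Y) / L ^ 2)
                + 4 * (11.84 * 2 * (2 * Y) / L ^ 2) + 3 * (11.84 * 1 * (2 * Y) / L ^ 2)
                + 2 * (11.84 * (4 / 3) * (2 * Y) / L ^ 2) + 2 * (11.84 * 2 * (2 * Y) / L ^ 2)
                + 2 * (11.84 * (6 / 5) * (2 * Y) / L ^ 2) + 11.84 * 1 * (2 * Y) / L ^ 2
                = (249232 / 375) * Y / L ^ 2 := by
              field_simp
              ring
            have e3 : (249232 / 375 : ℝ) * Y / L ^ 2 ≤ 664.7 * Y / L ^ 2 :=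
              div_le_div_of_nonneg_right (mul_le_mul_of_nonneg_right (by norm_num) hY0) hL2.le
            rw [e1]
            linarith [hcombr, hπ3, hπ5, hπ7, hπ11, hπ13, hπ17, hπ19, hP2, hP4, hP6, hP8, hP10, hP12, hP14, hP16,
              e2, e3]
          have hkey : Y * L ^ 2 ≤ (h : ℝ) * G * L ^ 2 := by
            have e4 : ((13.14866 * Y - 70.43925) / L - 5 - 664.7 * Y / L ^ 2) * L ^ 2
                = 13.14866 * Y * L - 70.43925 * L - 5 * L ^ 2 - 664.7 * Y := by
              field_simp
            have h1 : (13.14866 * Y * L - 70.43925 * L - 5 * L ^ 2 - 664.7 * Y) * h ≤ G * L ^ 2 * h := by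
              rw [← e4]
              exact mul_le_mul_of_nonneg_right (mul_le_mul_of_nonneg_right hG1 hL2.le) hh0.le
            have h2 : Y * (L ^ 2 + h) ≤ Y * (h * (13.14866 * L - 664.7)) :=
              mul_le_mul_of_nonneg_left hq (by linarith)
            have h3 : 70.43925 * L + 5 * L ^ 2 ≤ Y := by
              nlinarith [mul_nonneg (sub_nonneg.2 hL4) hLpos.le]
            have h3' : (h : ℝ) * (70.43925 * L + 5 * L ^ 2) ≤ h * Y := mul_le_mul_of_nonneg_left h3 hh0.le
            nlinarith [h1, h2, h3']
          have hfin := le_of_mul_le_mul_right hkey hL2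
          rw [div_le_iff₀ hh0, mul_comm]
          exact hfin
        · -- TWELVE SHIFTS on `(e^{L₃}, e^{Λ₀})`, pair sieve at the threshold `e^190`
          have hq := hquad12 L hmid3.le hLΛ.le
          have he190 : Real.exp 190 ≤ ((2 * y : ℕ) : ℝ) := by
            have : Real.exp 190 ≤ Real.exp L := Real.exp_le_exp.mpr (hL₃.trans hmid3.le)
            rwa [hLdef, Real.exp_log h2y0] at this
          have hPt : ∀ d : ℕ, d ≠ 0 → Even d →
              (#((Nat.primesLE (2 * y)).filter (fun p => (p + d).Prime)) : ℝ)
                ≤ 11.52 * oddSingularFactor d * ((2 * y : ℕ) : ℝ) / L ^ 2 := by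
            intro d hd hde
            rw [hLdef]
            exact pairCount_le_1152 (N := 2 * y) (h := d) he190 hd hde
          have hQ2 := hPt 2 (by norm_num) (by norm_num)
          have hQ4 := hPt 4 (by norm_num) (by norm_num)
          have hQ6 := hPt 6 (by norm_num) (by norm_num)
          have hQ8 := hPt 8 (by norm_num) (by norm_num)
          have hQ10 := hPt 10 (by norm_num) (by norm_num)
          have hQ12 := hPt 12 (by norm_num) (by norm_num)
          have hQ14 := hPt 14 (by norm_num) (by norm_num)
          have hQ16 := hPt 16 (by norm_num) (by norm_num)
          have hQ18 := hPt 18 (by norm_num) (by norm_num)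
          have hQ20 := hPt 20 (by norm_num) (by norm_num)
          have hQ22 := hPt 22 (by norm_num) (by norm_num)
          have hQ24 := hPt 24 (by norm_num) (by norm_num)
          have hQ26 := hPt 26 (by norm_num) (by norm_num)
          have hQ28 := hPt 28 (by norm_num) (by norm_num)
          have hQ30 := hPt 30 (by norm_num) (by norm_num)
          have hQ32 := hPt 32 (by norm_num) (by norm_num)
          have hQ34 := hPt 34 (by norm_num) (by norm_num)
          have hQ36 := hPt 36 (by norm_num) (by norm_num)
          have hQ38 := hPt 38 (by norm_num) (by norm_num)
          rw [oddSingularFactor_two'] at hQ2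
          rw [oddSingularFactor_four] at hQ4
          rw [oddSingularFactor_six] at hQ6
          rw [oddSingularFactor_eight] at hQ8
          rw [oddSingularFactor_ten] at hQ10
          rw [oddSingularFactor_twelve] at hQ12
          rw [oddSingularFactor_fourteen] at hQ14
          rw [oddSingularFactor_sixteen] at hQ16
          rw [oddSingularFactor_eighteen] at hQ18
          rw [oddSingularFactor_twenty] at hQ20
          rw [oddSingularFactor_twentytwo] at hQ22
          rw [oddSingularFactor_twentyfour] at hQ24
          rw [oddSingularFactor_twentysix] at hQ26
          rw [oddSingularFactor_twentyeight] at hQ28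
          rw [oddSingularFactor_thirty] at hQ30
          rw [oddSingularFactor_thirtytwo] at hQ32
          rw [oddSingularFactor_thirtyfour] at hQ34
          rw [oddSingularFactor_thirtysix] at hQ36
          rw [oddSingularFactor_thirtyeight] at hQ38
          have hcomb := twelve_shift_count (y := y) (by omega)
          have hcombr : (Nat.primeCounting (2 * y - 3) : ℝ) + Nat.primeCounting (2 * y - 5)
              + Nat.primeCounting (2 * y - 7) + Nat.primeCounting (2 * y - 11) + Nat.primeCounting (2 * y - 13)
              + Nat.primeCounting (2 * y - 17) + Nat.primeCounting (2 * y - 19) + Nat.primeCounting (2 * y - 23)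
              + Nat.primeCounting (2 * y - 29) + Nat.primeCounting (2 * y - 31) + Nat.primeCounting (2 * y - 37)
              + Nat.primeCounting (2 * y - 41)
              ≤ (#{b ∈ Ioc 0 y | b ∈ (({0, 1} : Set ℕ) ∪ {m | ∃ p q : ℕ, p.Prime ∧ q.Prime ∧ p + q = 2 * m})} : ℝ) + 10
                + (5 * #((Nat.primesLE (2 * y)).filter (fun p => (p + 2).Prime))
                  + 5 * #((Nat.primesLE (2 * y)).filter (fun p => (p + 4).Prime))
                  + 7 * #((Nat.primesLE (2 * y)).filter (fun p => (p + 6).Prime))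
                  + 5 * #((Nat.primesLE (2 * y)).filter (fun p => (p + 8).Prime))
                  + 5 * #((Nat.primesLE (2 * y)).filter (fun p => (p + 10).Prime))
                  + 6 * #((Nat.primesLE (2 * y)).filter (fun p => (p + 12).Prime))
                  + 4 * #((Nat.primesLE (2 * y)).filter (fun p => (p + 14).Prime))
                  + 3 * #((Nat.primesLE (2 * y)).filter (fun p => (p + 16).Prime))
                  + 5 * #((Nat.primesLE (2 * y)).filter (fun p => (p + 18).Prime))
                  + 3 * #((Nat.primesLE (2 * y)).filter (fun p => (p + 20).Prime))
                  + 2 * #((Nat.primesLE (2 * y)).filter (fun p => (p + 22).Prime))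
                  + 4 * #((Nat.primesLE (2 * y)).filter (fun p => (p + 24).Prime))
                  + 3 * #((Nat.primesLE (2 * y)).filter (fun p => (p + 26).Prime))
                  + 2 * #((Nat.primesLE (2 * y)).filter (fun p => (p + 28).Prime))
                  + 2 * #((Nat.primesLE (2 * y)).filter (fun p => (p + 30).Prime))
                  + #((Nat.primesLE (2 * y)).filter (fun p => (p + 32).Prime))
                  + 2 * #((Nat.primesLE (2 * y)).filter (fun p => (p + 34).Prime))
                  + #((Nat.primesLE (2 * y)).filter (fun p => (p + 36).Prime))
                  + #((Nat.primesLE (2 * y)).filter (fun p => (p + 38).Prime))) := by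
            exact_mod_cast hcomb
          have hπ3 := hπ 3 (by norm_num)
          have hπ5 := hπ 5 (by norm_num)
          have hπ7 := hπ 7 (by norm_num)
          have hπ11 := hπ 11 (by norm_num)
          have hπ13 := hπ 13 (by norm_num)
          have hπ17 := hπ 17 (by norm_num)
          have hπ19 := hπ 19 (by norm_num)
          have hπ23 := hπ 23 (by norm_num)
          have hπ29 := hπ 29 (by norm_num)
          have hπ31 := hπ 31 (by norm_num)
          have hπ37 := hπ 37 (by norm_num)
          have hπ41 := hπ 41 (by norm_num)
          push_cast at hπ3 hπ5 hπ7 hπ11 hπ13 hπ17 hπ19 hπ23 hπ29 hπ31 hπ37 hπ41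
          have h2yr : ((2 * y : ℕ) : ℝ) = 2 * (y : ℝ) := by push_cast; ring
          rw [h2yr] at hQ2 hQ4 hQ6 hQ8 hQ10 hQ12 hQ14 hQ16 hQ18 hQ20 hQ22 hQ24 hQ26 hQ28 hQ30 hQ32 hQ34 hQ36 hQ38
          set G : ℝ := (#{b ∈ Ioc 0 y | b ∈ (({0, 1} : Set ℕ) ∪ {m | ∃ p q : ℕ, p.Prime ∧ q.Prime ∧ p + q = 2 * m})} : ℝ) with hG
          set Y : ℝ := (y : ℝ) with hY
          have hY0 : 0 ≤ Y := le_trans (by norm_num) hy58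
          have hL2 : (0 : ℝ) < L ^ 2 := by positivity
          have hG1 : (22.54056 * Y - 221.64884) / L - 10 - 2233 * Y / L ^ 2 ≤ G := by
            have e1 : (22.54056 * Y - 221.64884) / L
                = 0.93919 * (2 * Y - 3) / L + 0.93919 * (2 * Y - 5) / L + 0.93919 * (2 * Y - 7) / L + 0.93919 * (2 * Y - 11) / L
                  + 0.93919 * (2 * Y - 13) / L + 0.93919 * (2 * Y - 17) / L + 0.93919 * (2 * Y - 19) / L + 0.93919 * (2 * Y - 23) / L
                  + 0.93919 * (2 * Y - 29) / L + 0.93919 * (2 * Y - 31) / L + 0.93919 * (2 * Y - 37) / L + 0.93919 * (2 * Y - 41) / L := by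
              field_simp
              ring
            have e2 : 5 * (11.52 * 1 * (2 * Y) / L ^ 2)
                + 5 * (11.52 * 1 * (2 * Y) / L ^ 2)
                + 7 * (11.52 * 2 * (2 * Y) / L ^ 2)
                + 5 * (11.52 * 1 * (2 * Y) / L ^ 2)
                + 5 * (11.52 * (4 / 3) * (2 * Y) / L ^ 2)
                + 6 * (11.52 * 2 * (2 * Y) / L ^ 2)
                + 4 * (11.52 * (6 / 5) * (2 * Y) / L ^ 2)
                + 3 * (11.52 * 1 * (2 * Y) / L ^ 2)
                + 5 * (11.52 * 2 * (2 * Y) / L ^ 2)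
                + 3 * (11.52 * (4 / 3) * (2 * Y) / L ^ 2)
                + 2 * (11.52 * (10 / 9) * (2 * Y) / L ^ 2)
                + 4 * (11.52 * 2 * (2 * Y) / L ^ 2)
                + 3 * (11.52 * (12 / 11) * (2 * Y) / L ^ 2)
                + 2 * (11.52 * (6 / 5) * (2 * Y) / L ^ 2)
                + 2 * (11.52 * (8 / 3) * (2 * Y) / L ^ 2)
                + 11.52 * 1 * (2 * Y) / L ^ 2
                + 2 * (11.52 * (16 / 15) * (2 * Y) / L ^ 2)
                + 11.52 * 2 * (2 * Y) / L ^ 2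
                + 11.52 * (18 / 17) * (2 * Y) / L ^ 2
                = (93923136 / 42075) * Y / L ^ 2 := by
              field_simp
              ring
            have e3 : (93923136 / 42075 : ℝ) * Y / L ^ 2 ≤ 2233 * Y / L ^ 2 :=
              div_le_div_of_nonneg_right (mul_le_mul_of_nonneg_right (by norm_num) hY0) hL2.le
            rw [e1]
            linarith [hcombr, hπ3, hπ5, hπ7, hπ11, hπ13, hπ17, hπ19, hπ23, hπ29, hπ31, hπ37, hπ41,
              hQ2, hQ4, hQ6, hQ8, hQ10, hQ12, hQ14, hQ16, hQ18, hQ20, hQ22, hQ24, hQ26, hQ28, hQ30, hQ32, hQ34, hQ36, hQ38, e2, e3]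
          have hkey : Y * L ^ 2 ≤ (h : ℝ) * G * L ^ 2 := by
            have e4 : ((22.54056 * Y - 221.64884) / L - 10 - 2233 * Y / L ^ 2) * L ^ 2
                = 22.54056 * Y * L - 221.64884 * L - 10 * L ^ 2 - 2233 * Y := by
              field_simp
            have h1 : (22.54056 * Y * L - 221.64884 * L - 10 * L ^ 2 - 2233 * Y) * h ≤ G * L ^ 2 * h := by
              rw [← e4]
              exact mul_le_mul_of_nonneg_right (mul_le_mul_of_nonneg_right hG1 hL2.le) hh0.le
            have h2 : Y * (L ^ 2 + h) ≤ Y * (h * (22.54056 * L - 2233)) :=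
              mul_le_mul_of_nonneg_left hq (by linarith)
            have h3 : 221.64884 * L + 10 * L ^ 2 ≤ Y := by
              nlinarith [mul_nonneg (sub_nonneg.2 hL4) hLpos.le]
            have h3' : (h : ℝ) * (221.64884 * L + 10 * L ^ 2) ≤ h * Y := mul_le_mul_of_nonneg_left h3 hh0.le
            nlinarith [h1, h2, h3']
          have hfin := le_of_mul_le_mul_right hkey hL2
          rw [div_le_iff₀ hh0, mul_comm]
          exact hfin


/-! ### §26.6 Instances: the count `x/42` above `e^330`, the unconditional glue with `h = 21`, density `1/21`, Mann: `K ≤ 43` -/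

/-- **Unconditional, above `e^330`**: at least `x/42` EVEN Goldbach numbers in `(0, x]` (`J = 400` levels, gap 16;
`Λs = 314`, `A = 11.33` from the `c = 16` sieve on the 68 cells with the harmonic constant, `c₁ = 0.441`;
`(1/42)⁷·259.55·11.33⁸ = 0.3057 ≤ (0.4409·gHol4 330 − 0.00005)⁸ = 0.3171`). [cite: Nathanson1996, Theorem 7.8 (proof, restricted to even N; explicit form proved here)] -/
theorem goldbach_even_count_ge_42_exp330 {x : ℕ} (hx : Real.exp 330 ≤ (x : ℝ)) :
    (x : ℝ) / 42 ≤ #{N ∈ Ioc 0 x | Even N ∧ ∃ p q : ℕ, p.Prime ∧ q.Prime ∧ p + q = N} := by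
  have h := goldbach_even_count_ge_holder400g (Λs := 314) (Λ₀ := 330) (A := 11.33) (c₁ := 0.441) (κ := 1 / 42)
    (by norm_num) (by norm_num) (by norm_num) (by norm_num) (by norm_num)
    (fun N hN hev => goldbachCount_le_1133 hN hev) (by norm_num) (by norm_num)
    (fun y hy => sum_goldbachCount_ge_0441 ((Real.exp_le_exp.mpr (by norm_num)).trans hy))
    (by unfold gHol4; norm_num) (by unfold gHol4; norm_num) hx
  have e : (1 : ℝ) / 42 * x = x / 42 := by ring
  rw [e] at h
  exact h

/-- **Unconditional count for all `y ≥ 1`**: `B(y) ≥ y/21` (one shift below `e^38 ≤ e^{1.8424·21}`, three shifts on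
`[38, 100]` (pair sieve `13.01` from `e^38`), four on `[100, 109]`, seven on `[109, 190]` (`11.84`), twelve on `[190, 330]`
(`11.52`), the count `x/42` above `e^330`; windows `[16.3, 102.1]`, `[30.1, 127.7]`, `[66.8, 209.4]`, `[141.3, 332.1]`). [cite: Nathanson1996, Theorem 7.8 (explicit constant for the halved set proved here)] -/
theorem half_count_ge_allN_21 {y : ℕ} (hy : 1 ≤ y) :
    (y : ℝ) / 21 ≤ #{b ∈ Ioc 0 y | b ∈ (({0, 1} : Set ℕ) ∪ {m | ∃ p q : ℕ, p.Prime ∧ q.Prime ∧ p + q = 2 * m})} := by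
  have h := half_count_ge_allN_three38 (L₁ := 38) (Lt := 100) (L₂ := 109) (L₃ := 190) (Λ₀ := 330) (h := 21)
    (by norm_num) (by norm_num) (by norm_num) (by norm_num) (by norm_num) (by norm_num)
    (fun L h1 h2 => by
      push_cast
      nlinarith [mul_nonneg (sub_nonneg.2 h1) (sub_nonneg.2 h2)])
    (fun L h1 h2 => by
      push_cast
      nlinarith [mul_nonneg (sub_nonneg.2 h1) (sub_nonneg.2 h2)])
    (fun L h1 h2 => by
      push_cast
      nlinarith [mul_nonneg (sub_nonneg.2 h1) (sub_nonneg.2 h2)])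
    (fun L h1 h2 => by
      push_cast
      nlinarith [mul_nonneg (sub_nonneg.2 h1) (sub_nonneg.2 h2)])
    (fun x hx => by
      have h1 := goldbach_even_count_ge_42_exp330 hx
      have e : (x : ℝ) / (2 * ((21 : ℕ) : ℝ)) = (x : ℝ) / 42 := by norm_num
      rw [e]
      exact h1) hy
  exact_mod_cast h

/-- **The halved density, `1/21`**: `σ({0, 1} ∪ {m : 2m = p + q}) ≥ 1/21`, unconditionally. [cite: Nathanson1996, Theorem 7.8 (explicit constant for the halved set proved here)] -/
theorem schnirelmannDensity_half_ge_21 :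
    (1 : ℝ) / 21 ≤ schnirelmannDensity
      (({0, 1} : Set ℕ) ∪ {m | ∃ p q : ℕ, p.Prime ∧ q.Prime ∧ p + q = 2 * m}) := by
  have h := schnirelmannDensity_ge_of_count' (K := 21)
    (S := ({0, 1} : Set ℕ) ∪ {m | ∃ p q : ℕ, p.Prime ∧ q.Prime ∧ p + q = 2 * m})
    (fun N hN => by have := half_count_ge_allN_21 hN; exact_mod_cast this)
  exact_mod_cast h

/-- ★★★★★★★★★★★★★★★★★★ **UNCONDITIONAL: every integer `N ≥ 2` is a sum of at most `43` primes** (ROUND-42 «HARMONIC»: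
the constant `(γ + log 2)/2 ≥ 0.6351` of the odd harmonic sum restored in the explicit two-residue Selberg sum
(`Dodd_ge_sharp`, `TlowK4 = 0.3658 l² + 0.3394 l − 1.3336` on the `68` odd `19`-smooth squarefull cells), pair sieves
`13.01`/`11.84`/`11.52` from `e^38`/`e^109`/`e^190`, Goldbach sieve `11.33` from `e^314`, count `x/42` above `e^330`, the
unconditional five-regime glue with the three shifts `{3,5,7}` from `e^38` and Chebyshev's `(n+2)/20 ≤ π(n)` below `10⁶`,
`h = 21`, Mann `2·21 + 1`).  ZERO named facts.  (ROUND-40/41: `45`.)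
[cite: Nathanson1996, Thm 7.9 (Shnirel'man–Goldbach; explicit constant proved here)] -/
theorem schnirelmann_goldbach_le_43 (N : ℕ) (hN : 2 ≤ N) :
    ∃ M : Multiset ℕ, (∀ p ∈ M, p.Prime) ∧ Multiset.card M ≤ 43 ∧ M.sum = N := by
  have hσ : (1 : ℝ) / ((21 : ℕ) : ℝ) ≤ schnirelmannDensity
      (({0, 1} : Set ℕ) ∪ {m | ∃ p q : ℕ, p.Prime ∧ q.Prime ∧ p + q = 2 * m}) := by
    have := schnirelmannDensity_half_ge_21
    exact_mod_cast this
  exact sum_of_primes_of_half_density_mann (h := 21) (by norm_num) hσ N hN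


/-! ## §27 ROUND-43 «c₀»: the Chebyshev lower constant `0.9212/0.93919` ↦ Costa Pereira's `0.9636` (above `227`), read through §26 -/

/-! ### §27.1 The count input: `π(n) ≥ 0.9636·n/log n` (`n ≥ 227`), the first moment `0.4642`, the Goldbach sieve `11.34` from `e^308` -/

/-- **`π(n) ≥ 0.9636·n/log n` for every `n ≥ 227`** (Costa Pereira's `m = 17` scheme, `ChebyshevCostaPereira.lean`). [cite: CostaPereira1989, (2.41) p. 323 (constant `0.9636` proved in the tree)] -/
theorem primeCountingLowerMul_09636 : PrimeCountingLowerMul 0.9636 227 := fun _ hn => Literature.NumberTheory.LFunctions.CostaPereira.primeCounting_ge hn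

/-- **First moment, `0.4642`, from `e^41`** (`0.9636²/2 = 0.46426`; `x₁ = 227`). [cite: Nathanson1996, Theorem 7.8 (first moment of the Goldbach count; explicit constant `0.9636²/2` proved here)] -/
theorem sum_goldbachCount_ge_04642 {x : ℕ} (hx : Real.exp 41 ≤ (x : ℝ)) :
    0.4642 * ((x : ℝ) ^ 2 / Real.log x ^ 2) ≤ ∑ N ∈ range (x + 1), (SingularSeries.goldbachCount N : ℝ) := by
  have hbig : (2 : ℝ) ^ 59 ≤ x := two_pow_59_le_exp_41.trans hx
  have hx2 : 2 * 227 ≤ x := by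
    have : ((2 * 227 : ℕ) : ℝ) ≤ x := by push_cast; linarith
    exact_mod_cast this
  have h := sum_goldbachCount_ge_of_lower (by norm_num) (by norm_num) primeCountingLowerMul_09636 hx2
  refine le_trans ?_ h
  have hx1 : (1 : ℝ) < x := by linarith
  have hL : 0 < Real.log x := Real.log_pos hx1
  have hL2 : 0 < 2 * Real.log x ^ 2 := by positivity
  have hxn : (0 : ℝ) ≤ x := by linarith
  have key : 0.4642 * (x : ℝ) ^ 2 * 2 ≤ 0.9636 ^ 2 * (((x : ℝ) - ((227 : ℕ) : ℝ)) ^ 2 - ((227 : ℕ) : ℝ) ^ 2) := by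
    push_cast
    nlinarith [mul_le_mul_of_nonneg_right hbig hxn]
  calc 0.4642 * ((x : ℝ) ^ 2 / Real.log x ^ 2) = (0.4642 * (x : ℝ) ^ 2 * 2) / (2 * Real.log x ^ 2) := by
        field_simp
    _ ≤ 0.9636 ^ 2 * (((x : ℝ) - ((227 : ℕ) : ℝ)) ^ 2 - ((227 : ℕ) : ℝ) ^ 2) / (2 * Real.log x ^ 2) :=
        div_le_div_of_nonneg_right key hL2.le
    _ = 0.9636 ^ 2 * ((((x : ℝ) - ((227 : ℕ) : ℝ)) ^ 2 - ((227 : ℕ) : ℝ) ^ 2) / (2 * Real.log x ^ 2)) := by ring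

/-- `c = 16` numerics at `Λ = 308` on `TlowK4`: `257L² ≤ 256·11.32·TlowK4(L/2 − 2.7728)` for `L ≥ 308`. [folklore] -/
private theorem cells16_numeric4_308 {L : ℝ} (hL : 308 ≤ L) :
    (((16 : ℕ) : ℝ) ^ 2 + 1) * L ^ 2 ≤ ((16 : ℕ) : ℝ) ^ 2 * (11.34 - 0.02) * TlowK4 (L / 2 - 2.7728) := by
  unfold TlowK4
  push_cast
  nlinarith [hL, mul_self_nonneg (L - 308)]

/-- **GOLDBACH SIEVE `11.34` above `e^308`** (`c = 16`, 68 cells, harmonic constant):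
`r(N) ≤ 11.34·f(N)·N/log²N` for even `N ≥ e^308`. [cite: BatemanDiamond2004, §13.4 (13.13)–(13.14)] -/
theorem goldbachCount_le_1134 {N : ℕ} (hN : Real.exp 308 ≤ (N : ℝ)) (heven : Even N) :
    (SingularSeries.goldbachCount N : ℝ) ≤ 11.34 * oddSingularFactor N * (N : ℝ) / Real.log (N : ℝ) ^ 2 :=
  goldbachCount_le_of_numeric4_c (c := 16) (lc := 2.7728) (by norm_num) (by norm_num)
    (by have := exp_27728_ge; push_cast; linarith) (by norm_num) (by norm_num)
    (fun _ hL => cells16_numeric4_308 hL) hN heven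

/-! ### §27.2  The unconditional five-regime glue from `L₁ ≥ 38` with `h ≥ 20` (round42 §E with Costa Pereira's count constant
`0.9636` (`ChebyshevCostaPereira.lean`) in place of Sylvester's `0.93919`/`0.9212`; thresholds `38/109/190`, pair constants `13.01/11.84/11.52`, weights `78.06/182.14/664.7/2233`) -/

set_option maxHeartbeats 4000000 in
/-- **UNCONDITIONAL GLUE FOR ALL `y ≥ 1`, FIVE REGIMES, `h ≥ 20`, `L₁ ≥ 38`** (ROUND-43 «c₀»; round42 §E with Costa Pereira's constant): one shift below `e^{L₁}`
(`L₁ ≤ 1.9272h`, `π(n) ≥ 0.9636 n/log n` above `227` (`ChebyshevCostaPereira.lean`), `(n+2)/20 ≤ π(n)` on `[122, 227)`, `π ≥ 3` below), THREE shifts `{3,5,7}` on `(e^{L₁}, e^{Lt}]` (`three_shift_count`, pair weight `2·13.01·3 = 78.06`,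
the `e^38` pair sieve `pairCount_le_1301`, Costa Pereira counts `0.9636·(2y−q)/L`), FOUR shifts on `(e^{Lt}, e^{L₂}]`
(weight `182.14`), SEVEN shifts on `(e^{L₂}, e^{L₃}]` (`pairCount_le_1184` from `e^109`, weight `249232/375 ≤ 664.7`), TWELVE
shifts on `(e^{L₃}, e^{Λ₀})` (`pairCount_le_1152` from `e^190`, weight `93923136/42075 ≤ 2233`), the count above `e^{Λ₀}`:
`L² + h ≤ h·(5.7816L − 78.06)` on `[L₁, Lt]`, `L² + h ≤ h·(7.7088L − 182.14)` on `[Lt, L₂]`,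
`L² + h ≤ h·(13.4904L − 664.7)` on `[L₂, L₃]`, `L² + h ≤ h·(23.1264L − 2233)` on `[L₃, Λ₀]`; requires `L₁ ≥ 38`. [cite: Nathanson1996, Theorem 7.8 (five-regime explicit form for the halved Goldbach set, Costa Pereira count constant; proved here)] -/
theorem half_count_ge_allN_cp38 {L₁ Lt L₂ L₃ Λ₀ : ℝ} {h : ℕ} (h20 : 20 ≤ h) (h38 : 38 ≤ L₁) (hL₁h : L₁ ≤ 1.9272 * h)
    (hL₂ : 109 ≤ L₂) (hL₃ : 190 ≤ L₃) (hΛ4 : Λ₀ ≤ 10000)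
    (hquad3 : ∀ L : ℝ, L₁ ≤ L → L ≤ Lt → L ^ 2 + h ≤ h * (5.7816 * L - 78.06))
    (hquad : ∀ L : ℝ, Lt ≤ L → L ≤ L₂ → L ^ 2 + h ≤ h * (7.7088 * L - 182.14))
    (hquad7 : ∀ L : ℝ, L₂ ≤ L → L ≤ L₃ → L ^ 2 + h ≤ h * (13.4904 * L - 664.7))
    (hquad12 : ∀ L : ℝ, L₃ ≤ L → L ≤ Λ₀ → L ^ 2 + h ≤ h * (23.1264 * L - 2233))
    (hlarge : ∀ x : ℕ, Real.exp Λ₀ ≤ (x : ℝ) →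
      (x : ℝ) / (2 * h) ≤ #{N ∈ Ioc 0 x | Even N ∧ ∃ p q : ℕ, p.Prime ∧ q.Prime ∧ p + q = N})
    {y : ℕ} (hy : 1 ≤ y) :
    (y : ℝ) / h ≤ #{b ∈ Ioc 0 y | b ∈ (({0, 1} : Set ℕ) ∪ {m | ∃ p q : ℕ, p.Prime ∧ q.Prime ∧ p + q = 2 * m})} := by
  set B : Set ℕ := ({0, 1} : Set ℕ) ∪ {m | ∃ p q : ℕ, p.Prime ∧ q.Prime ∧ p + q = 2 * m} with hB
  have hhr : (20 : ℝ) ≤ h := by exact_mod_cast h20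
  have hh0 : (0 : ℝ) < h := by linarith
  have hL₁pos : (0 : ℝ) < L₁ := by linarith
  by_cases hbig : Real.exp Λ₀ ≤ ((2 * y : ℕ) : ℝ)
  · have h1 := hlarge (2 * y) hbig
    have h2 := even_goldbach_card_le_half y
    have e : ((2 * y : ℕ) : ℝ) / (2 * h) = (y : ℝ) / h := by
      push_cast
      field_simp
    rw [e] at h1
    exact h1.trans (by exact_mod_cast h2)
  rw [not_le] at hbig
  by_cases hsmall : y ≤ h
  · have h1 : 1 ≤ #{b ∈ Ioc 0 y | b ∈ B} :=
      card_pos.mpr ⟨1, by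
        rw [mem_filter, mem_Ioc]
        exact ⟨⟨by omega, hy⟩, Or.inl (by simp)⟩⟩
    have h1' : (1 : ℝ) ≤ #{b ∈ Ioc 0 y | b ∈ B} := by exact_mod_cast h1
    have h2 : (y : ℝ) / h ≤ 1 := by
      rw [div_le_one hh0]
      exact_mod_cast hsmall
    linarith
  rw [not_le] at hsmall
  have hy29 : 21 ≤ y := by omega
  have hnr : ((2 * y - 3 : ℕ) : ℝ) = 2 * (y : ℝ) - 3 := cast_two_mul_sub_three (by omega)
  have hy29r : (21 : ℝ) ≤ y := by exact_mod_cast hy29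
  have hy0 : (0 : ℝ) < y := by linarith
  have hn55 : 39 ≤ 2 * y - 3 := by omega
  have hn0 : (0 : ℝ) < ((2 * y - 3 : ℕ) : ℝ) := by rw [hnr]; linarith
  have hn1 : (1 : ℝ) < ((2 * y - 3 : ℕ) : ℝ) := by rw [hnr]; linarith
  have hlogpos : 0 < Real.log ((2 * y - 3 : ℕ) : ℝ) := Real.log_pos hn1
  by_cases hmid : Real.log ((2 * y - 3 : ℕ) : ℝ) ≤ L₁
  · -- ONE SHIFT below `e^{L₁}` (§15)
    have hemb := primeCounting_shift_le_half_count (y := y) (by omega)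
    have hembr : (Nat.primeCounting (2 * y - 3) : ℝ) + 1 ≤ #{b ∈ Ioc 0 y | b ∈ B} := by exact_mod_cast hemb
    refine le_trans ?_ hembr
    by_cases h6 : 227 ≤ 2 * y - 3
    · have hπ : 0.9636 * ((2 * y - 3 : ℕ) : ℝ) / Real.log ((2 * y - 3 : ℕ) : ℝ)
          ≤ (Nat.primeCounting (2 * y - 3) : ℝ) := Literature.NumberTheory.LFunctions.CostaPereira.primeCounting_ge h6
      have h2 : 0.9636 * ((2 * y - 3 : ℕ) : ℝ) / L₁
          ≤ 0.9636 * ((2 * y - 3 : ℕ) : ℝ) / Real.log ((2 * y - 3 : ℕ) : ℝ) :=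
        div_le_div_of_nonneg_left (by positivity) hlogpos hmid
      have h3 : (y : ℝ) / h ≤ 1.9272 * y / L₁ := by
        rw [div_le_div_iff₀ hh0 hL₁pos]
        nlinarith [mul_le_mul_of_nonneg_left hL₁h hy0.le]
      have h4 : 1.9272 * (y : ℝ) / L₁ ≤ 0.9636 * ((2 * y - 3 : ℕ) : ℝ) / L₁ + 1 := by
        rw [hnr]
        have e : 0.9636 * (2 * (y : ℝ) - 3) / L₁ = 1.9272 * y / L₁ - 2.8908 / L₁ := by
          field_simp
          ring
        rw [e]
        have : 2.8908 / L₁ ≤ 1 := by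
          rw [div_le_one hL₁pos]
          linarith
        linarith
      linarith [h2, h3, h4, hπ]
    · rw [not_le] at h6
      -- `2y − 3 < 227`: Chebyshev pointwise `(n + 2)/20 ≤ π(n)` for `n ≥ 122` (§7.3), `π(n) ≥ π(5) = 3` below
      by_cases h88 : 122 ≤ 2 * y - 3
      · have hlog14 : Real.log ((2 * y - 3 : ℕ) : ℝ) ≤ 14 := log_le_14_of_lt (by omega) (by omega)
        have hπ := primeCounting_ge_div20 h88 hlog14
        rw [hnr] at hπ
        have h6' : (y : ℝ) / h ≤ (y : ℝ) / 20 := div_le_div_of_nonneg_left hy0.le (by norm_num) hhr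
        have h7 : (y : ℝ) / 20 ≤ (2 * (y : ℝ) - 3 + 2) / 20 + 1 := by
          rw [div_le_iff₀ (by norm_num : (0 : ℝ) < 20)]
          linarith
        linarith [hπ, h6', h7]
      · rw [not_le] at h88
        have hπ5 : Nat.primeCounting 5 = 3 := by decide
        have hmono := Nat.monotone_primeCounting (show 5 ≤ 2 * y - 3 by omega)
        rw [hπ5] at hmono
        have hπ3 : (3 : ℝ) ≤ (Nat.primeCounting (2 * y - 3) : ℝ) := by exact_mod_cast hmono
        have hy62 : (y : ℝ) ≤ 62 := by exact_mod_cast (show y ≤ 62 by omega)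
        have h7 : (y : ℝ) / h ≤ 4 := by
          rw [div_le_iff₀ hh0]
          linarith
        linarith
  · -- SHIFTS on `(e^{L₁}, e^{Λ₀})`: three / four / seven / twelve
    rw [not_le] at hmid
    have h59 : (18014398509481984 : ℝ) < ((2 * y - 3 : ℕ) : ℝ) := by
      have h1 : Real.exp L₁ < ((2 * y - 3 : ℕ) : ℝ) := by
        by_contra hc
        rw [not_lt] at hc
        have := Real.log_le_log hn0 hc
        rw [Real.log_exp] at this
        linarith
      exact lt_of_le_of_lt (numeral_le_exp_38.trans (Real.exp_le_exp.mpr h38)) h1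
    have h59n : 18014398509481984 < 2 * y - 3 := by exact_mod_cast h59
    have hy58 : (9007199254740992 : ℝ) ≤ (y : ℝ) := by
      have : 9007199254740992 ≤ y := by omega
      exact_mod_cast this
    have h2y0 : (0 : ℝ) < ((2 * y : ℕ) : ℝ) := by push_cast; linarith
    set L := Real.log ((2 * y : ℕ) : ℝ) with hLdef
    have hLΛ : L < Λ₀ := by
      have := Real.log_lt_log h2y0 hbig
      rwa [Real.log_exp] at this
    have hL₁L : L₁ ≤ L := by
      have h2y : ((2 * y - 3 : ℕ) : ℝ) ≤ ((2 * y : ℕ) : ℝ) := by rw [hnr]; push_cast; linarith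
      exact (hmid.trans_le (Real.log_le_log hn0 h2y)).le
    have hL40 : (38 : ℝ) ≤ L := h38.trans hL₁L
    have hLpos : (0 : ℝ) < L := by linarith
    have hL4 : L ≤ 10000 := by linarith
    have he40 : Real.exp 38 ≤ ((2 * y : ℕ) : ℝ) := by
      have : Real.exp 38 ≤ Real.exp L := Real.exp_le_exp.mpr hL40
      rwa [hLdef, Real.exp_log h2y0] at this
    -- the prime counts, Costa Pereira's constant (`ChebyshevCostaPereira.lean`)
    have hπ : ∀ q : ℕ, q ≤ 41 → 0.9636 * (2 * (y : ℝ) - q) / L ≤ (Nat.primeCounting (2 * y - q) : ℝ) := by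
      intro q hq
      have hqr : (q : ℝ) ≤ 41 := by exact_mod_cast hq
      have hnq : ((2 * y - q : ℕ) : ℝ) = 2 * (y : ℝ) - q := cast_two_mul_sub (by omega)
      have h6 : 227 ≤ 2 * y - q := by omega
      have hnq0 : (0 : ℝ) < ((2 * y - q : ℕ) : ℝ) := by rw [hnq]; linarith
      have hnq1 : (1 : ℝ) < ((2 * y - q : ℕ) : ℝ) := by rw [hnq]; linarith
      have h1 : 0.9636 * ((2 * y - q : ℕ) : ℝ) / Real.log ((2 * y - q : ℕ) : ℝ)
          ≤ (Nat.primeCounting (2 * y - q) : ℝ) := Literature.NumberTheory.LFunctions.CostaPereira.primeCounting_ge h6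
      have hlogq0 : 0 < Real.log ((2 * y - q : ℕ) : ℝ) := Real.log_pos hnq1
      have hlogq : Real.log ((2 * y - q : ℕ) : ℝ) ≤ L := by
        have h2y : ((2 * y - q : ℕ) : ℝ) ≤ ((2 * y : ℕ) : ℝ) := by
          rw [hnq]; push_cast; linarith [Nat.cast_nonneg (α := ℝ) q]
        exact Real.log_le_log hnq0 h2y
      have h2 : 0.9636 * (2 * (y : ℝ) - q) / L
          ≤ 0.9636 * ((2 * y - q : ℕ) : ℝ) / Real.log ((2 * y - q : ℕ) : ℝ) := by
        rw [← hnq]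
        exact div_le_div_of_nonneg_left (by positivity) hlogq0 hlogq
      linarith
    -- the pair counts (the 68-cell pair sieve with the harmonic constant above `e^38`, ROUND-42)
    have hP : ∀ d : ℕ, d ≠ 0 → Even d →
        (#((Nat.primesLE (2 * y)).filter (fun p => (p + d).Prime)) : ℝ)
          ≤ 13.01 * oddSingularFactor d * ((2 * y : ℕ) : ℝ) / L ^ 2 := by
      intro d hd hde
      exact pairCount_le_1301 (N := 2 * y) (h := d) he40 hd hde
    rcases le_or_gt L Lt with hmidt | hmidt
    · -- THREE SHIFTS `{3, 5, 7}` on `(e^{L₁}, e^{Lt}]`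
      have hq := hquad3 L hL₁L hmidt
      have hP2 := hP 2 (by norm_num) (by norm_num)
      have hP4 := hP 4 (by norm_num) (by norm_num)
      rw [oddSingularFactor_two'] at hP2
      rw [oddSingularFactor_four] at hP4
      have hcomb := three_shift_count (y := y) (by omega)
      have hcombr : (Nat.primeCounting (2 * y - 3) : ℝ) + Nat.primeCounting (2 * y - 5)
          + Nat.primeCounting (2 * y - 7)
          ≤ (#{b ∈ Ioc 0 y | b ∈ B} : ℝ) + 2
            + (2 * #((Nat.primesLE (2 * y)).filter (fun p => (p + 2).Prime))
              + #((Nat.primesLE (2 * y)).filter (fun p => (p + 4).Prime))) := by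
        exact_mod_cast hcomb
      have hπ3 := hπ 3 (by norm_num)
      have hπ5 := hπ 5 (by norm_num)
      have hπ7 := hπ 7 (by norm_num)
      push_cast at hπ3 hπ5 hπ7
      have h2yr : ((2 * y : ℕ) : ℝ) = 2 * (y : ℝ) := by push_cast; ring
      rw [h2yr] at hP2 hP4
      set G : ℝ := (#{b ∈ Ioc 0 y | b ∈ B} : ℝ) with hG
      set Y : ℝ := (y : ℝ) with hY
      -- `G ≥ (5.7816 Y − 14.454)/L − 2 − 78.06 Y/L²`
      have hG1 : (5.7816 * Y - 14.454) / L - 2 - 78.06 * Y / L ^ 2 ≤ G := by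
        have e1 : (5.7816 * Y - 14.454) / L = 0.9636 * (2 * Y - 3) / L + 0.9636 * (2 * Y - 5) / L
            + 0.9636 * (2 * Y - 7) / L := by
          field_simp
          ring
        have e2 : 78.06 * Y / L ^ 2 = 2 * (13.01 * 1 * (2 * Y) / L ^ 2) + 13.01 * 1 * (2 * Y) / L ^ 2 := by
          field_simp
          ring
        rw [e1, e2]
        linarith [hcombr, hπ3, hπ5, hπ7, hP2, hP4]
      have hL2 : (0 : ℝ) < L ^ 2 := by positivity
      have hkey : Y * L ^ 2 ≤ (h : ℝ) * G * L ^ 2 := by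
        have e3 : ((5.7816 * Y - 14.454) / L - 2 - 78.06 * Y / L ^ 2) * L ^ 2
            = 5.7816 * Y * L - 14.454 * L - 2 * L ^ 2 - 78.06 * Y := by
          field_simp
        have h1 : (5.7816 * Y * L - 14.454 * L - 2 * L ^ 2 - 78.06 * Y) * h ≤ G * L ^ 2 * h := by
          rw [← e3]
          exact mul_le_mul_of_nonneg_right (mul_le_mul_of_nonneg_right hG1 hL2.le) hh0.le
        have h2 : Y * (L ^ 2 + h) ≤ Y * (h * (5.7816 * L - 78.06)) :=
          mul_le_mul_of_nonneg_left hq (by linarith)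
        have h3 : 14.454 * L + 2 * L ^ 2 ≤ Y := by
          nlinarith [mul_nonneg (sub_nonneg.2 hL4) hLpos.le]
        have h3' : (h : ℝ) * (14.454 * L + 2 * L ^ 2) ≤ h * Y := mul_le_mul_of_nonneg_left h3 hh0.le
        nlinarith [h1, h2, h3']
      have hfin := le_of_mul_le_mul_right hkey hL2
      rw [div_le_iff₀ hh0, mul_comm]
      exact hfin
    · rcases le_or_gt L L₂ with hmid2 | hmid2
      · -- FOUR SHIFTS on `(e^{Lt}, e^{L₂}]`
        have hq := hquad L hmidt.le hmid2
        have hP2 := hP 2 (by norm_num) (by norm_num)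
        have hP4 := hP 4 (by norm_num) (by norm_num)
        have hP6 := hP 6 (by norm_num) (by norm_num)
        have hP8 := hP 8 (by norm_num) (by norm_num)
        rw [oddSingularFactor_two'] at hP2
        rw [oddSingularFactor_four] at hP4
        rw [oddSingularFactor_six] at hP6
        rw [oddSingularFactor_eight] at hP8
        -- combinatorics
        have hcomb := four_shift_count (y := y) (by omega)
        have hcombr : (Nat.primeCounting (2 * y - 3) : ℝ) + Nat.primeCounting (2 * y - 5)
            + Nat.primeCounting (2 * y - 7) + Nat.primeCounting (2 * y - 11)
            ≤ (#{b ∈ Ioc 0 y | b ∈ B} : ℝ) + 2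
              + (2 * #((Nat.primesLE (2 * y)).filter (fun p => (p + 2).Prime))
                + 2 * #((Nat.primesLE (2 * y)).filter (fun p => (p + 4).Prime))
                + #((Nat.primesLE (2 * y)).filter (fun p => (p + 8).Prime))
                + #((Nat.primesLE (2 * y)).filter (fun p => (p + 6).Prime))) := by
          exact_mod_cast hcomb
        have hπ3 := hπ 3 (by norm_num)
        have hπ5 := hπ 5 (by norm_num)
        have hπ7 := hπ 7 (by norm_num)
        have hπ11 := hπ 11 (by norm_num)
        push_cast at hπ3 hπ5 hπ7 hπ11
        have h2yr : ((2 * y : ℕ) : ℝ) = 2 * (y : ℝ) := by push_cast; ring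
        rw [h2yr] at hP2 hP4 hP6 hP8
        set G : ℝ := (#{b ∈ Ioc 0 y | b ∈ B} : ℝ) with hG
        set Y : ℝ := (y : ℝ) with hY
        -- `G ≥ (7.7088 Y − 25.0536)/L − 2 − 182.14 Y/L²`
        have hG1 : (7.7088 * Y - 25.0536) / L - 2 - 182.14 * Y / L ^ 2 ≤ G := by
          have e1 : (7.7088 * Y - 25.0536) / L = 0.9636 * (2 * Y - 3) / L + 0.9636 * (2 * Y - 5) / L
              + 0.9636 * (2 * Y - 7) / L + 0.9636 * (2 * Y - 11) / L := by
            field_simp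
            ring
          have e2 : 182.14 * Y / L ^ 2 = 2 * (13.01 * 1 * (2 * Y) / L ^ 2) + 2 * (13.01 * 1 * (2 * Y) / L ^ 2)
              + 13.01 * 1 * (2 * Y) / L ^ 2 + 13.01 * 2 * (2 * Y) / L ^ 2 := by
            field_simp
            ring
          rw [e1, e2]
          linarith [hcombr, hπ3, hπ5, hπ7, hπ11, hP2, hP4, hP6, hP8]
        have hL2 : (0 : ℝ) < L ^ 2 := by positivity
        have hkey : Y * L ^ 2 ≤ (h : ℝ) * G * L ^ 2 := by
          have e3 : ((7.7088 * Y - 25.0536) / L - 2 - 182.14 * Y / L ^ 2) * L ^ 2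
              = 7.7088 * Y * L - 25.0536 * L - 2 * L ^ 2 - 182.14 * Y := by
            field_simp
          have h1 : (7.7088 * Y * L - 25.0536 * L - 2 * L ^ 2 - 182.14 * Y) * h ≤ G * L ^ 2 * h := by
            rw [← e3]
            exact mul_le_mul_of_nonneg_right (mul_le_mul_of_nonneg_right hG1 hL2.le) hh0.le
          have h2 : Y * (L ^ 2 + h) ≤ Y * (h * (7.7088 * L - 182.14)) :=
            mul_le_mul_of_nonneg_left hq (by linarith)
          have h3 : 25.0536 * L + 2 * L ^ 2 ≤ Y := by
            nlinarith [mul_nonneg (sub_nonneg.2 hL4) hLpos.le]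
          have h3' : (h : ℝ) * (25.0536 * L + 2 * L ^ 2) ≤ h * Y := mul_le_mul_of_nonneg_left h3 hh0.le
          nlinarith [h1, h2, h3']
        have hfin := le_of_mul_le_mul_right hkey hL2
        rw [div_le_iff₀ hh0, mul_comm]
        exact hfin
      · rcases le_or_gt L L₃ with hmid3 | hmid3
        · -- SEVEN SHIFTS on `(e^{L₂}, e^{L₃}]`
          have hq := hquad7 L hmid2.le hmid3
          have he109 : Real.exp 109 ≤ ((2 * y : ℕ) : ℝ) := by
            have : Real.exp 109 ≤ Real.exp L := Real.exp_le_exp.mpr (hL₂.trans hmid2.le)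
            rwa [hLdef, Real.exp_log h2y0] at this
          have hP7 : ∀ d : ℕ, d ≠ 0 → Even d →
              (#((Nat.primesLE (2 * y)).filter (fun p => (p + d).Prime)) : ℝ)
                ≤ 11.84 * oddSingularFactor d * ((2 * y : ℕ) : ℝ) / L ^ 2 := by
            intro d hd hde
            rw [hLdef]
            exact pairCount_le_1184 (N := 2 * y) (h := d) he109 hd hde
          have hP2 := hP7 2 (by norm_num) (by norm_num)
          have hP4 := hP7 4 (by norm_num) (by norm_num)
          have hP6 := hP7 6 (by norm_num) (by norm_num)
          have hP8 := hP7 8 (by norm_num) (by norm_num)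
          have hP10 := hP7 10 (by norm_num) (by norm_num)
          have hP12 := hP7 12 (by norm_num) (by norm_num)
          have hP14 := hP7 14 (by norm_num) (by norm_num)
          have hP16 := hP7 16 (by norm_num) (by norm_num)
          rw [oddSingularFactor_two'] at hP2
          rw [oddSingularFactor_four] at hP4
          rw [oddSingularFactor_six] at hP6
          rw [oddSingularFactor_eight] at hP8
          rw [oddSingularFactor_ten] at hP10
          rw [oddSingularFactor_twelve] at hP12
          rw [oddSingularFactor_fourteen] at hP14
          rw [oddSingularFactor_sixteen] at hP16
          have hcomb := seven_shift_count (y := y) (by omega)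
          have hcombr : (Nat.primeCounting (2 * y - 3) : ℝ) + Nat.primeCounting (2 * y - 5)
              + Nat.primeCounting (2 * y - 7) + Nat.primeCounting (2 * y - 11) + Nat.primeCounting (2 * y - 13)
              + Nat.primeCounting (2 * y - 17) + Nat.primeCounting (2 * y - 19)
              ≤ (#{b ∈ Ioc 0 y | b ∈ B} : ℝ) + 5
                + (4 * #((Nat.primesLE (2 * y)).filter (fun p => (p + 2).Prime))
                  + 3 * #((Nat.primesLE (2 * y)).filter (fun p => (p + 4).Prime))
                  + 4 * #((Nat.primesLE (2 * y)).filter (fun p => (p + 6).Prime))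
                  + 3 * #((Nat.primesLE (2 * y)).filter (fun p => (p + 8).Prime))
                  + 2 * #((Nat.primesLE (2 * y)).filter (fun p => (p + 10).Prime))
                  + 2 * #((Nat.primesLE (2 * y)).filter (fun p => (p + 12).Prime))
                  + 2 * #((Nat.primesLE (2 * y)).filter (fun p => (p + 14).Prime))
                  + #((Nat.primesLE (2 * y)).filter (fun p => (p + 16).Prime))) := by
            exact_mod_cast hcomb
          have hπ3 := hπ 3 (by norm_num)
          have hπ5 := hπ 5 (by norm_num)
          have hπ7 := hπ 7 (by norm_num)
          have hπ11 := hπ 11 (by norm_num)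
          have hπ13 := hπ 13 (by norm_num)
          have hπ17 := hπ 17 (by norm_num)
          have hπ19 := hπ 19 (by norm_num)
          push_cast at hπ3 hπ5 hπ7 hπ11 hπ13 hπ17 hπ19
          have h2yr : ((2 * y : ℕ) : ℝ) = 2 * (y : ℝ) := by push_cast; ring
          rw [h2yr] at hP2 hP4 hP6 hP8 hP10 hP12 hP14 hP16
          set G : ℝ := (#{b ∈ Ioc 0 y | b ∈ B} : ℝ) with hG
          set Y : ℝ := (y : ℝ) with hY
          have hY0 : 0 ≤ Y := le_trans (by norm_num) hy58
          have hL2 : (0 : ℝ) < L ^ 2 := by positivity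
          have hG1 : (13.4904 * Y - 72.27) / L - 5 - 664.7 * Y / L ^ 2 ≤ G := by
            have e1 : (13.4904 * Y - 72.27) / L
                = 0.9636 * (2 * Y - 3) / L + 0.9636 * (2 * Y - 5) / L + 0.9636 * (2 * Y - 7) / L + 0.9636 * (2 * Y - 11) / L + 0.9636 * (2 * Y - 13) / L + 0.9636 * (2 * Y - 17) / L + 0.9636 * (2 * Y - 19) / L := by
              field_simp
              ring
            have e2 : 4 * (11.84 * 1 * (2 * Y) / L ^ 2) + 3 * (11.84 * 1 * (2 * Y) / L ^ 2)
                + 4 * (11.84 * 2 * (2 * Y) / L ^ 2) + 3 * (11.84 * 1 * (2 * Y) / L ^ 2)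
                + 2 * (11.84 * (4 / 3) * (2 * Y) / L ^ 2) + 2 * (11.84 * 2 * (2 * Y) / L ^ 2)
                + 2 * (11.84 * (6 / 5) * (2 * Y) / L ^ 2) + 11.84 * 1 * (2 * Y) / L ^ 2
                = (249232 / 375) * Y / L ^ 2 := by
              field_simp
              ring
            have e3 : (249232 / 375 : ℝ) * Y / L ^ 2 ≤ 664.7 * Y / L ^ 2 :=
              div_le_div_of_nonneg_right (mul_le_mul_of_nonneg_right (by norm_num) hY0) hL2.le
            rw [e1]
            linarith [hcombr, hπ3, hπ5, hπ7, hπ11, hπ13, hπ17, hπ19, hP2, hP4, hP6, hP8, hP10, hP12, hP14, hP16,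
              e2, e3]
          have hkey : Y * L ^ 2 ≤ (h : ℝ) * G * L ^ 2 := by
            have e4 : ((13.4904 * Y - 72.27) / L - 5 - 664.7 * Y / L ^ 2) * L ^ 2
                = 13.4904 * Y * L - 72.27 * L - 5 * L ^ 2 - 664.7 * Y := by
              field_simp
            have h1 : (13.4904 * Y * L - 72.27 * L - 5 * L ^ 2 - 664.7 * Y) * h ≤ G * L ^ 2 * h := by
              rw [← e4]
              exact mul_le_mul_of_nonneg_right (mul_le_mul_of_nonneg_right hG1 hL2.le) hh0.le
            have h2 : Y * (L ^ 2 + h) ≤ Y * (h * (13.4904 * L - 664.7)) :=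
              mul_le_mul_of_nonneg_left hq (by linarith)
            have h3 : 72.27 * L + 5 * L ^ 2 ≤ Y := by
              nlinarith [mul_nonneg (sub_nonneg.2 hL4) hLpos.le]
            have h3' : (h : ℝ) * (72.27 * L + 5 * L ^ 2) ≤ h * Y := mul_le_mul_of_nonneg_left h3 hh0.le
            nlinarith [h1, h2, h3']
          have hfin := le_of_mul_le_mul_right hkey hL2
          rw [div_le_iff₀ hh0, mul_comm]
          exact hfin
        · -- TWELVE SHIFTS on `(e^{L₃}, e^{Λ₀})`, pair sieve at the threshold `e^190`
          have hq := hquad12 L hmid3.le hLΛ.le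
          have he190 : Real.exp 190 ≤ ((2 * y : ℕ) : ℝ) := by
            have : Real.exp 190 ≤ Real.exp L := Real.exp_le_exp.mpr (hL₃.trans hmid3.le)
            rwa [hLdef, Real.exp_log h2y0] at this
          have hPt : ∀ d : ℕ, d ≠ 0 → Even d →
              (#((Nat.primesLE (2 * y)).filter (fun p => (p + d).Prime)) : ℝ)
                ≤ 11.52 * oddSingularFactor d * ((2 * y : ℕ) : ℝ) / L ^ 2 := by
            intro d hd hde
            rw [hLdef]
            exact pairCount_le_1152 (N := 2 * y) (h := d) he190 hd hde
          have hQ2 := hPt 2 (by norm_num) (by norm_num)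
          have hQ4 := hPt 4 (by norm_num) (by norm_num)
          have hQ6 := hPt 6 (by norm_num) (by norm_num)
          have hQ8 := hPt 8 (by norm_num) (by norm_num)
          have hQ10 := hPt 10 (by norm_num) (by norm_num)
          have hQ12 := hPt 12 (by norm_num) (by norm_num)
          have hQ14 := hPt 14 (by norm_num) (by norm_num)
          have hQ16 := hPt 16 (by norm_num) (by norm_num)
          have hQ18 := hPt 18 (by norm_num) (by norm_num)
          have hQ20 := hPt 20 (by norm_num) (by norm_num)
          have hQ22 := hPt 22 (by norm_num) (by norm_num)
          have hQ24 := hPt 24 (by norm_num) (by norm_num)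
          have hQ26 := hPt 26 (by norm_num) (by norm_num)
          have hQ28 := hPt 28 (by norm_num) (by norm_num)
          have hQ30 := hPt 30 (by norm_num) (by norm_num)
          have hQ32 := hPt 32 (by norm_num) (by norm_num)
          have hQ34 := hPt 34 (by norm_num) (by norm_num)
          have hQ36 := hPt 36 (by norm_num) (by norm_num)
          have hQ38 := hPt 38 (by norm_num) (by norm_num)
          rw [oddSingularFactor_two'] at hQ2
          rw [oddSingularFactor_four] at hQ4
          rw [oddSingularFactor_six] at hQ6
          rw [oddSingularFactor_eight] at hQ8
          rw [oddSingularFactor_ten] at hQ10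
          rw [oddSingularFactor_twelve] at hQ12
          rw [oddSingularFactor_fourteen] at hQ14
          rw [oddSingularFactor_sixteen] at hQ16
          rw [oddSingularFactor_eighteen] at hQ18
          rw [oddSingularFactor_twenty] at hQ20
          rw [oddSingularFactor_twentytwo] at hQ22
          rw [oddSingularFactor_twentyfour] at hQ24
          rw [oddSingularFactor_twentysix] at hQ26
          rw [oddSingularFactor_twentyeight] at hQ28
          rw [oddSingularFactor_thirty] at hQ30
          rw [oddSingularFactor_thirtytwo] at hQ32
          rw [oddSingularFactor_thirtyfour] at hQ34
          rw [oddSingularFactor_thirtysix] at hQ36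
          rw [oddSingularFactor_thirtyeight] at hQ38
          have hcomb := twelve_shift_count (y := y) (by omega)
          have hcombr : (Nat.primeCounting (2 * y - 3) : ℝ) + Nat.primeCounting (2 * y - 5)
              + Nat.primeCounting (2 * y - 7) + Nat.primeCounting (2 * y - 11) + Nat.primeCounting (2 * y - 13)
              + Nat.primeCounting (2 * y - 17) + Nat.primeCounting (2 * y - 19) + Nat.primeCounting (2 * y - 23)
              + Nat.primeCounting (2 * y - 29) + Nat.primeCounting (2 * y - 31) + Nat.primeCounting (2 * y - 37)
              + Nat.primeCounting (2 * y - 41)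
              ≤ (#{b ∈ Ioc 0 y | b ∈ (({0, 1} : Set ℕ) ∪ {m | ∃ p q : ℕ, p.Prime ∧ q.Prime ∧ p + q = 2 * m})} : ℝ) + 10
                + (5 * #((Nat.primesLE (2 * y)).filter (fun p => (p + 2).Prime))
                  + 5 * #((Nat.primesLE (2 * y)).filter (fun p => (p + 4).Prime))
                  + 7 * #((Nat.primesLE (2 * y)).filter (fun p => (p + 6).Prime))
                  + 5 * #((Nat.primesLE (2 * y)).filter (fun p => (p + 8).Prime))
                  + 5 * #((Nat.primesLE (2 * y)).filter (fun p => (p + 10).Prime))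
                  + 6 * #((Nat.primesLE (2 * y)).filter (fun p => (p + 12).Prime))
                  + 4 * #((Nat.primesLE (2 * y)).filter (fun p => (p + 14).Prime))
                  + 3 * #((Nat.primesLE (2 * y)).filter (fun p => (p + 16).Prime))
                  + 5 * #((Nat.primesLE (2 * y)).filter (fun p => (p + 18).Prime))
                  + 3 * #((Nat.primesLE (2 * y)).filter (fun p => (p + 20).Prime))
                  + 2 * #((Nat.primesLE (2 * y)).filter (fun p => (p + 22).Prime))
                  + 4 * #((Nat.primesLE (2 * y)).filter (fun p => (p + 24).Prime))
                  + 3 * #((Nat.primesLE (2 * y)).filter (fun p => (p + 26).Prime))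
                  + 2 * #((Nat.primesLE (2 * y)).filter (fun p => (p + 28).Prime))
                  + 2 * #((Nat.primesLE (2 * y)).filter (fun p => (p + 30).Prime))
                  + #((Nat.primesLE (2 * y)).filter (fun p => (p + 32).Prime))
                  + 2 * #((Nat.primesLE (2 * y)).filter (fun p => (p + 34).Prime))
                  + #((Nat.primesLE (2 * y)).filter (fun p => (p + 36).Prime))
                  + #((Nat.primesLE (2 * y)).filter (fun p => (p + 38).Prime))) := by
            exact_mod_cast hcomb
          have hπ3 := hπ 3 (by norm_num)
          have hπ5 := hπ 5 (by norm_num)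
          have hπ7 := hπ 7 (by norm_num)
          have hπ11 := hπ 11 (by norm_num)
          have hπ13 := hπ 13 (by norm_num)
          have hπ17 := hπ 17 (by norm_num)
          have hπ19 := hπ 19 (by norm_num)
          have hπ23 := hπ 23 (by norm_num)
          have hπ29 := hπ 29 (by norm_num)
          have hπ31 := hπ 31 (by norm_num)
          have hπ37 := hπ 37 (by norm_num)
          have hπ41 := hπ 41 (by norm_num)
          push_cast at hπ3 hπ5 hπ7 hπ11 hπ13 hπ17 hπ19 hπ23 hπ29 hπ31 hπ37 hπ41
          have h2yr : ((2 * y : ℕ) : ℝ) = 2 * (y : ℝ) := by push_cast; ring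
          rw [h2yr] at hQ2 hQ4 hQ6 hQ8 hQ10 hQ12 hQ14 hQ16 hQ18 hQ20 hQ22 hQ24 hQ26 hQ28 hQ30 hQ32 hQ34 hQ36 hQ38
          set G : ℝ := (#{b ∈ Ioc 0 y | b ∈ (({0, 1} : Set ℕ) ∪ {m | ∃ p q : ℕ, p.Prime ∧ q.Prime ∧ p + q = 2 * m})} : ℝ) with hG
          set Y : ℝ := (y : ℝ) with hY
          have hY0 : 0 ≤ Y := le_trans (by norm_num) hy58
          have hL2 : (0 : ℝ) < L ^ 2 := by positivity
          have hG1 : (23.1264 * Y - 227.4096) / L - 10 - 2233 * Y / L ^ 2 ≤ G := by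
            have e1 : (23.1264 * Y - 227.4096) / L
                = 0.9636 * (2 * Y - 3) / L + 0.9636 * (2 * Y - 5) / L + 0.9636 * (2 * Y - 7) / L + 0.9636 * (2 * Y - 11) / L
                  + 0.9636 * (2 * Y - 13) / L + 0.9636 * (2 * Y - 17) / L + 0.9636 * (2 * Y - 19) / L + 0.9636 * (2 * Y - 23) / L
                  + 0.9636 * (2 * Y - 29) / L + 0.9636 * (2 * Y - 31) / L + 0.9636 * (2 * Y - 37) / L + 0.9636 * (2 * Y - 41) / L := by
              field_simp
              ring
            have e2 : 5 * (11.52 * 1 * (2 * Y) / L ^ 2)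
                + 5 * (11.52 * 1 * (2 * Y) / L ^ 2)
                + 7 * (11.52 * 2 * (2 * Y) / L ^ 2)
                + 5 * (11.52 * 1 * (2 * Y) / L ^ 2)
                + 5 * (11.52 * (4 / 3) * (2 * Y) / L ^ 2)
                + 6 * (11.52 * 2 * (2 * Y) / L ^ 2)
                + 4 * (11.52 * (6 / 5) * (2 * Y) / L ^ 2)
                + 3 * (11.52 * 1 * (2 * Y) / L ^ 2)
                + 5 * (11.52 * 2 * (2 * Y) / L ^ 2)
                + 3 * (11.52 * (4 / 3) * (2 * Y) / L ^ 2)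
                + 2 * (11.52 * (10 / 9) * (2 * Y) / L ^ 2)
                + 4 * (11.52 * 2 * (2 * Y) / L ^ 2)
                + 3 * (11.52 * (12 / 11) * (2 * Y) / L ^ 2)
                + 2 * (11.52 * (6 / 5) * (2 * Y) / L ^ 2)
                + 2 * (11.52 * (8 / 3) * (2 * Y) / L ^ 2)
                + 11.52 * 1 * (2 * Y) / L ^ 2
                + 2 * (11.52 * (16 / 15) * (2 * Y) / L ^ 2)
                + 11.52 * 2 * (2 * Y) / L ^ 2
                + 11.52 * (18 / 17) * (2 * Y) / L ^ 2
                = (93923136 / 42075) * Y / L ^ 2 := by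
              field_simp
              ring
            have e3 : (93923136 / 42075 : ℝ) * Y / L ^ 2 ≤ 2233 * Y / L ^ 2 :=
              div_le_div_of_nonneg_right (mul_le_mul_of_nonneg_right (by norm_num) hY0) hL2.le
            rw [e1]
            linarith [hcombr, hπ3, hπ5, hπ7, hπ11, hπ13, hπ17, hπ19, hπ23, hπ29, hπ31, hπ37, hπ41,
              hQ2, hQ4, hQ6, hQ8, hQ10, hQ12, hQ14, hQ16, hQ18, hQ20, hQ22, hQ24, hQ26, hQ28, hQ30, hQ32, hQ34, hQ36, hQ38, e2, e3]
          have hkey : Y * L ^ 2 ≤ (h : ℝ) * G * L ^ 2 := by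
            have e4 : ((23.1264 * Y - 227.4096) / L - 10 - 2233 * Y / L ^ 2) * L ^ 2
                = 23.1264 * Y * L - 227.4096 * L - 10 * L ^ 2 - 2233 * Y := by
              field_simp
            have h1 : (23.1264 * Y * L - 227.4096 * L - 10 * L ^ 2 - 2233 * Y) * h ≤ G * L ^ 2 * h := by
              rw [← e4]
              exact mul_le_mul_of_nonneg_right (mul_le_mul_of_nonneg_right hG1 hL2.le) hh0.le
            have h2 : Y * (L ^ 2 + h) ≤ Y * (h * (23.1264 * L - 2233)) :=
              mul_le_mul_of_nonneg_left hq (by linarith)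
            have h3 : 227.4096 * L + 10 * L ^ 2 ≤ Y := by
              nlinarith [mul_nonneg (sub_nonneg.2 hL4) hLpos.le]
            have h3' : (h : ℝ) * (227.4096 * L + 10 * L ^ 2) ≤ h * Y := mul_le_mul_of_nonneg_left h3 hh0.le
            nlinarith [h1, h2, h3']
          have hfin := le_of_mul_le_mul_right hkey hL2
          rw [div_le_iff₀ hh0, mul_comm]
          exact hfin


/-! ### §27.3 Instances: the count `x/40` above `e^324`, the unconditional glue with `h = 20`, density `1/20`, Mann: `K ≤ 41` -/

/-- **Unconditional, above `e^324`**: at least `x/40` EVEN Goldbach numbers in `(0, x]` (`J = 400` levels, gap 16;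
`Λs = 308`, `A = 11.34` from the `c = 16` sieve on the 68 cells with the harmonic constant, `c₁ = 0.4642 = 0.9636²/2`
(Costa Pereira); `(1/40)⁷·259.55·11.34⁸ = 0.4332 ≤ (0.4641·gHol4 324 − 0.00005)⁸ = 0.4778`). [cite: Nathanson1996, Theorem 7.8 (proof, restricted to even N; explicit form proved here)] -/
theorem goldbach_even_count_ge_40_exp324 {x : ℕ} (hx : Real.exp 324 ≤ (x : ℝ)) :
    (x : ℝ) / 40 ≤ #{N ∈ Ioc 0 x | Even N ∧ ∃ p q : ℕ, p.Prime ∧ q.Prime ∧ p + q = N} := by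
  have h := goldbach_even_count_ge_holder400g (Λs := 308) (Λ₀ := 324) (A := 11.34) (c₁ := 0.4642) (κ := 1 / 40)
    (by norm_num) (by norm_num) (by norm_num) (by norm_num) (by norm_num)
    (fun N hN hev => goldbachCount_le_1134 hN hev) (by norm_num) (by norm_num)
    (fun y hy => sum_goldbachCount_ge_04642 ((Real.exp_le_exp.mpr (by norm_num)).trans hy))
    (by unfold gHol4; norm_num) (by unfold gHol4; norm_num) hx
  have e : (1 : ℝ) / 40 * x = x / 40 := by ring
  rw [e] at h
  exact h

/-- **Unconditional count for all `y ≥ 1`**: `B(y) ≥ y/20` (one shift below `e^38 ≤ e^{1.9272·20}`, three shifts on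
`[38, 99]` (pair sieve `13.01` from `e^38`), four on `[99, 109]`, seven on `[109, 190]` (`11.84`), twelve on `[190, 324]`
(`11.52`), the count `x/40` above `e^324`; windows `[15.8, 99.8]`, `[29.3, 124.8]`, `[65.0, 204.8]`, `[137.4, 325.1]`). [cite: Nathanson1996, Theorem 7.8 (explicit constant for the halved set proved here)] -/
theorem half_count_ge_allN_20 {y : ℕ} (hy : 1 ≤ y) :
    (y : ℝ) / 20 ≤ #{b ∈ Ioc 0 y | b ∈ (({0, 1} : Set ℕ) ∪ {m | ∃ p q : ℕ, p.Prime ∧ q.Prime ∧ p + q = 2 * m})} := by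
  have h := half_count_ge_allN_cp38 (L₁ := 38) (Lt := 99) (L₂ := 109) (L₃ := 190) (Λ₀ := 324) (h := 20)
    (by norm_num) (by norm_num) (by norm_num) (by norm_num) (by norm_num) (by norm_num)
    (fun L h1 h2 => by
      push_cast
      nlinarith [mul_nonneg (sub_nonneg.2 h1) (sub_nonneg.2 h2)])
    (fun L h1 h2 => by
      push_cast
      nlinarith [mul_nonneg (sub_nonneg.2 h1) (sub_nonneg.2 h2)])
    (fun L h1 h2 => by
      push_cast
      nlinarith [mul_nonneg (sub_nonneg.2 h1) (sub_nonneg.2 h2)])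
    (fun L h1 h2 => by
      push_cast
      nlinarith [mul_nonneg (sub_nonneg.2 h1) (sub_nonneg.2 h2)])
    (fun x hx => by
      have h1 := goldbach_even_count_ge_40_exp324 hx
      have e : (x : ℝ) / (2 * ((20 : ℕ) : ℝ)) = (x : ℝ) / 40 := by norm_num
      rw [e]
      exact h1) hy
  exact_mod_cast h

/-- **The halved density, `1/20`**: `σ({0, 1} ∪ {m : 2m = p + q}) ≥ 1/20`, unconditionally. [cite: Nathanson1996, Theorem 7.8 (explicit constant for the halved set proved here)] -/
theorem schnirelmannDensity_half_ge_20 :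
    (1 : ℝ) / 20 ≤ schnirelmannDensity
      (({0, 1} : Set ℕ) ∪ {m | ∃ p q : ℕ, p.Prime ∧ q.Prime ∧ p + q = 2 * m}) := by
  have h := schnirelmannDensity_ge_of_count' (K := 20)
    (S := ({0, 1} : Set ℕ) ∪ {m | ∃ p q : ℕ, p.Prime ∧ q.Prime ∧ p + q = 2 * m})
    (fun N hN => by have := half_count_ge_allN_20 hN; exact_mod_cast this)
  exact_mod_cast h

/-- ★★★★★★★★★★★★★★★★★★★ **UNCONDITIONAL: every integer `N ≥ 2` is a sum of at most `41` primes** (ROUND-43 «c₀»: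
Costa Pereira's elementary `ψ(x) ≥ 0.9636·x` (`x ≥ 227`, the `m = 17` scheme of Acta Arith. 52 (1989), kernel-certified
here: `F` of period 30030 with `−1 ≤ F ≤ 4`, block comparison at `Z = 2000`, `lcm(1..n)` base range to `5·10⁴`, the tree's
`θ`-table to `10⁶`, linear induction with error `15 log x + 30`) replaces Sylvester's `0.93919`/`0.9212` in the count side of
ROUND-42's glue; one shift then reaches `1.9272·20 ≥ 38`, count `x/40` above `e^324`, `h = 20`, Mann `2·20 + 1`).
ZERO named facts.  (ROUND-42: `43`; ROUND-40/41: `45`.)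
[cite: Nathanson1996, Thm 7.9 (Shnirel'man–Goldbach; explicit constant proved here)] -/
theorem schnirelmann_goldbach_le_41 (N : ℕ) (hN : 2 ≤ N) :
    ∃ M : Multiset ℕ, (∀ p ∈ M, p.Prime) ∧ Multiset.card M ≤ 41 ∧ M.sum = N := by
  have hσ : (1 : ℝ) / ((20 : ℕ) : ℝ) ≤ schnirelmannDensity
      (({0, 1} : Set ℕ) ∪ {m | ∃ p q : ℕ, p.Prime ∧ q.Prime ∧ p + q = 2 * m}) := by
    have := schnirelmannDensity_half_ge_20
    exact_mod_cast this
  exact sum_of_primes_of_half_density_mann (h := 20) (by norm_num) hσ N hN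

end Literature.NumberTheory.Sieve.ShnirelmanGoldbachExplicit
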